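import Mathlib
import Literature.Analysis.FluidPDE.TypeIAncientMild
import Literature.Analysis.FluidPDE.HyperbolicDSSOrbit
import Literature.Analysis.FluidPDE.AncientSimilarityVariables
import Literature.Analysis.FluidPDE.AncientSimilarityVorticity
import Literature.Analysis.FluidPDE.VorticityCalculus
import Literature.Analysis.FluidPDE.RadialSmoothCutoff
import Literature.Analysis.FluidPDE.NullLagrangianDeterminant
import Literature.Analysis.FluidPDE.LerayGaugeStrainSpectrum
import Literature.Analysis.FluidPDE.WholeSpaceIBP
import Literature.Analysis.FluidPDE.WholeSpaceIBPEnstrophy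
import Literature.Analysis.FluidPDE.SpaceTimeCalculusC1
import Literature.Analysis.FluidPDE.TypeIAncientMildClassical
import Literature.Analysis.FluidPDE.LerayProfileCalculus
import Summits.NavierStokesRegularity.NavierStokesRegularity.Theorems.SqueezeCycleMustSqueezeAlgebra

import Summits.NavierStokesRegularity.NavierStokesRegularity.Theorems.SqueezeCycleMustSqueezeGronwall
import Summits.NavierStokesRegularity.NavierStokesRegularity.Theorems.SqueezeCycleMustSqueezeSimDictionary
import Summits.NavierStokesRegularity.NavierStokesRegularity.Theorems.SqueezeCycleMustSqueezeEndgame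
import Summits.NavierStokesRegularity.NavierStokesRegularity.Theorems.SqueezeCycleExtremalBiaxialitySubcriticalOfLiouville

/-!
# `MustSqueeze` (stmt-NavierStokesRegularity-11610) — complete sorry-free proof along the picked line
  `outward-drift-signed-flux` (lead skeleton v1, sha 75fd2eb7)

Candidate proof assembled by the drefute gen-2 seat (refuter-drefute-stmt-NavierStokesRegularity-11610-g2-0)
from: the tree's landed `Theorems.stub_simDictionary` (p71854), `Theorems.stub_endgame` (p72077),
`Theorems.backward_gronwall_bound` (p70331), `Theorems.inner_fderiv_curl_le` (p70183),
`Theorems.isTypeIAncientMild_of_squeezeClass`; gen-1 drefute's verbatim proofs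
`Drefute.stub_twoPassGronwall`, `Drefute.stub_gradEnergyBasic` (copied below, namespace `Drefute`);
this seat's verbatim proofs `DrefuteG2.stub_signedBudget` (the lever), `DrefuteG2.stub_divCurlBalls`,
`DrefuteG2.stub_gradEnergyAverage` (namespace `DrefuteG2`); and the skeleton's composition, unchanged,
as `Summit.….Theorems.mustSqueeze_outwardDriftSignedFlux : Theses.SqueezeCycle.MustSqueeze`.
A refuter cannot land a positive Theses decl — this file is EVIDENCE for the lead / a prover to land.
-/

noncomputable section

open MeasureTheory Set Filter Real Metric
open scoped ContDiff RealInnerProductSpace Laplacian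
open Literature.Analysis.FluidPDE

namespace DrefuteG2

local notation "ℝ³" => EuclideanSpace ℝ (Fin 3)

variable {C a : ℝ} {u : ℝ → ℝ³ → ℝ³}

/-! ## Regularity of the orbit (as in gen-1's StubBitsV3) -/

/-- Slices of the similarity orbit of a class element are smooth. -/
theorem contDiff_lerayOrbit_slice (hu : IsTypeIAncientMild C u) (s : ℝ) {n : ℕ∞} :
    ContDiff ℝ n (lerayOrbit u s) := by
  have h : ContDiff ℝ n (Function.uncurry (lerayOrbit u)) :=
    contDiff_uncurry_lerayOrbit (hu.1.of_le (by exact_mod_cast le_top))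
  exact h.comp (contDiff_prodMk_right s)

/-- The Frobenius gradient density of a slice is continuous. -/
theorem continuous_frobeniusNormSq_fderiv_lerayOrbit (hu : IsTypeIAncientMild C u) (s : ℝ) :
    Continuous fun y => frobeniusNormSq (fderiv ℝ (lerayOrbit u s) y) := by
  have hc : Continuous (fderiv ℝ (lerayOrbit u s)) :=
    (contDiff_lerayOrbit_slice hu s (n := 1)).continuous_fderiv one_ne_zero
  unfold frobeniusNormSq
  exact continuous_finsetSum _ fun i _ => ((hc.clm_apply continuous_const).norm).pow 2

/-- The vorticity of a slice is continuous. -/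
theorem continuous_lerayVorticity (hu : IsTypeIAncientMild C u) (s : ℝ) :
    Continuous (lerayVorticity u s) := by
  rw [lerayVorticity_apply]
  exact continuous_curl (contDiff_lerayOrbit_slice hu s (n := 1))

/-- Integrability of the Frobenius density on balls. -/
theorem integrableOn_frobeniusNormSq_ball (hu : IsTypeIAncientMild C u) (s ρ : ℝ) :
    IntegrableOn (fun y => frobeniusNormSq (fderiv ℝ (lerayOrbit u s) y)) (ball (0 : ℝ³) ρ) :=
  (((continuous_frobeniusNormSq_fderiv_lerayOrbit hu s).continuousOn).integrableOn_compact
    (isCompact_closedBall (0 : ℝ³) ρ)).mono_set ball_subset_closedBall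

/-- `B_ρ` and its closure agree up to a null set (the sphere is Lebesgue-null). -/
theorem ball_ae_eq_closedBall' (ρ : ℝ) :
    (ball (0 : ℝ³) ρ : Set ℝ³) =ᵐ[volume] (closedBall (0 : ℝ³) ρ : Set ℝ³) := by
  rw [← ball_union_sphere]
  exact (union_ae_eq_left_of_ae_eq_empty (ae_eq_empty.2 (Measure.addHaar_sphere volume _ _))).symm

/-- `0 ≤ E(ρ, s)`. -/
theorem ballGradEnergy_nonneg (u : ℝ → ℝ³ → ℝ³) (ρ s : ℝ) :
    0 ≤ ∫ y in ball (0 : ℝ³) ρ, frobeniusNormSq (fderiv ℝ (lerayOrbit u s) y) :=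
  setIntegral_nonneg measurableSet_ball fun _ _ => frobeniusNormSq_nonneg _

/-! ## The dictionary: trace-free gradient, middle eigenvalue of the orbit -/

/-- `tr DU(s, y) = 0` (the orbit is divergence free). -/
theorem trace_fderiv_lerayOrbit_eq_zero (hu : IsTypeIAncientMild C u) (s : ℝ) (y : ℝ³) :
    LinearMap.trace ℝ ℝ³ (fderiv ℝ (lerayOrbit u s) y : ℝ³ →ₗ[ℝ] ℝ³) = 0 := by
  have ht : -Real.exp (-s) < (0 : ℝ) := neg_neg_of_pos (Real.exp_pos _)
  exact (isDivFree_lerayOrbit_iff u s).2 (hu.isDivFree ht) y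

/-- **`λ₂(sym DU(s,y)) ≤ a`** from `lerayMiddleStrain u ≤ a` (Courant–Fischer both ways:
`DU(s,y) = e^{-s} • Du(t,x)` and `e^{-s} = -t`). -/
theorem strainEigenvalues_fderiv_lerayOrbit_le (hΛ : ∀ t < 0, ∀ x, lerayMiddleStrain u t x ≤ a)
    (s : ℝ) (y : ℝ³) :
    strainEigenvalues (fderiv ℝ (lerayOrbit u s) y : ℝ³ →ₗ[ℝ] ℝ³) finrank_euclideanSpace_fin 1 ≤ a := by
  have ht : -Real.exp (-s) < (0 : ℝ) := neg_neg_of_pos (Real.exp_pos _)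
  obtain ⟨v, w, hv, hw, hvw, h⟩ :=
    (lerayMiddleStrain_le_iff ht a).1 (hΛ _ ht (Real.exp (-s / 2) • y))
  refine (strainEigenvalues_mid_le_iff _ finrank_euclideanSpace_fin a).2 ⟨v, w, hv, hw, hvw, fun α β => ?_⟩
  have key := h α β
  rw [neg_neg] at key
  rw [ContinuousLinearMap.coe_coe, fderiv_lerayOrbit, FunLike.coe_smul, Pi.smul_apply,
    real_inner_smul_left]
  exact key

/-- **Pointwise production bound on the orbit**:
`⟪DU Ω, Ω⟫ ≤ 4 det DU + a (2 ‖DU‖²_F − ‖Ω‖²)` (`inner_fderiv_curl_le` with the dictionary, and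
`tr(DU ∘ DU) = ‖DU‖²_F − ‖Ω‖²`). -/
theorem production_pointwise (hu : IsTypeIAncientMild C u)
    (hΛ : ∀ t < 0, ∀ x, lerayMiddleStrain u t x ≤ a) (ha : 0 ≤ a) (s : ℝ) (y : ℝ³) :
    ⟪fderiv ℝ (lerayOrbit u s) y (lerayVorticity u s y), lerayVorticity u s y⟫ ≤
      4 * LinearMap.det (fderiv ℝ (lerayOrbit u s) y : ℝ³ →ₗ[ℝ] ℝ³) +
        a * (2 * frobeniusNormSq (fderiv ℝ (lerayOrbit u s) y) - ‖lerayVorticity u s y‖ ^ 2) := by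
  have key := Summit.NavierStokesRegularity.NavierStokesRegularity.Theorems.inner_fderiv_curl_le
    (v := lerayOrbit u s) (y := y) ha (trace_fderiv_lerayOrbit_eq_zero hu s y)
    (strainEigenvalues_fderiv_lerayOrbit_le hΛ s y)
  have hcurl := Summit.NavierStokesRegularity.NavierStokesRegularity.Theorems.norm_curl_sq_eq_frobeniusNormSq_sub_trace
    (lerayOrbit u s) y
  rw [lerayVorticity_apply]
  have e : frobeniusNormSq (fderiv ℝ (lerayOrbit u s) y) +
      LinearMap.trace ℝ ℝ³ ((fderiv ℝ (lerayOrbit u s) y : ℝ³ →ₗ[ℝ] ℝ³) ∘ₗ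
        (fderiv ℝ (lerayOrbit u s) y : ℝ³ →ₗ[ℝ] ℝ³)) =
      2 * frobeniusNormSq (fderiv ℝ (lerayOrbit u s) y) - ‖curl (lerayOrbit u s) y‖ ^ 2 := by
    linarith
  rw [← e]
  exact key

/-! ## The cutoff `φ_R` -/

/-- The cutoff vanishes identically near every point outside `closedBall 0 (2R)`. -/
theorem tsupport_cutoff_subset {R : ℝ} (hR : 0 < R) :
    tsupport (fun y : ℝ³ => smoothTransition (2 - ‖y‖ ^ 2 / R ^ 2)) ⊆ closedBall (0 : ℝ³) (2 * R) := by
  refine closure_minimal (fun y hy => ?_) isClosed_closedBall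
  by_contra h
  exact hy (smoothTransition_cutoff_eq_zero_of_notMem hR h)

/-- Off `closedBall 0 (2R)` the gradient of the cutoff vanishes. -/
theorem fderiv_cutoff_eq_zero {R : ℝ} (hR : 0 < R) {y : ℝ³} (hy : y ∉ closedBall (0 : ℝ³) (2 * R)) :
    fderiv ℝ (fun z : ℝ³ => smoothTransition (2 - ‖z‖ ^ 2 / R ^ 2)) y = 0 :=
  fderiv_of_notMem_tsupport ℝ fun h => hy (tsupport_cutoff_subset hR h)

/-- Off `closedBall 0 (2R)` the Laplacian of the cutoff vanishes. -/
theorem laplacian_cutoff_eq_zero {R : ℝ} (hR : 0 < R) {y : ℝ³} (hy : y ∉ closedBall (0 : ℝ³) (2 * R)) :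
    (Δ (fun z : ℝ³ => smoothTransition (2 - ‖z‖ ^ 2 / R ^ 2))) y = 0 :=
  laplacian_eq_zero_of_notMem_tsupport fun h => hy (tsupport_cutoff_subset hR h)

/-- `‖∇φ‖ = ‖Dφ‖`. -/
theorem norm_gradient_eq (φ : ℝ³ → ℝ) (y : ℝ³) : ‖gradient φ y‖ = ‖fderiv ℝ φ y‖ := by
  rw [gradient, LinearIsometryEquiv.norm_map]


/-- Pointwise: `‖curl v‖² ≤ 2 ‖∇v‖²_F` (gen-1, StubBitsV3). -/
theorem norm_curl_sq_le_two_mul_frobeniusNormSq (v : ℝ³ → ℝ³) (y : ℝ³) :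
    ‖curl v y‖ ^ 2 ≤ 2 * frobeniusNormSq (fderiv ℝ v y) := by
  rw [Summit.NavierStokesRegularity.NavierStokesRegularity.Theorems.norm_curl_sq_eq_frobeniusNormSq_sub_trace]
  have htr : LinearMap.trace ℝ ℝ³ ((fderiv ℝ v y : ℝ³ →ₗ[ℝ] ℝ³) ∘ₗ (fderiv ℝ v y : ℝ³ →ₗ[ℝ] ℝ³)) =
      (stdMatrix (fderiv ℝ v y : ℝ³ →ₗ[ℝ] ℝ³) * stdMatrix (fderiv ℝ v y : ℝ³ →ₗ[ℝ] ℝ³)).trace := by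
    rw [← trace_stdMatrix, stdMatrix_comp]
  rw [htr, frobeniusNormSq_eq_sum_sq_stdMatrix]
  set M := stdMatrix (fderiv ℝ v y : ℝ³ →ₗ[ℝ] ℝ³)
  simp only [Matrix.trace, Matrix.diag, Matrix.mul_apply, Fin.sum_univ_three]
  nlinarith [sq_nonneg (M 0 1 + M 1 0), sq_nonneg (M 0 2 + M 2 0), sq_nonneg (M 1 2 + M 2 1),
    sq_nonneg (M 0 0), sq_nonneg (M 1 1), sq_nonneg (M 2 2)]

/-! ## Flux bounds against `φ_R` -/

section Flux

variable (hu : IsTypeIAncientMild C u)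

/-- A continuous function vanishing off `closedBall 0 ρ` is integrable, and its integral is the
integral over the closed ball. -/
theorem integrable_of_continuous_of_eq_zero {f : ℝ³ → ℝ} (hf : Continuous f) {ρ : ℝ}
    (h0 : ∀ y ∉ closedBall (0 : ℝ³) ρ, f y = 0) : Integrable f :=
  hf.integrable_of_hasCompactSupport (HasCompactSupport.intro (isCompact_closedBall _ _) h0)

/-- `∫_{closedBall 0 ρ} k · frob = k · E(ρ)`. -/
theorem setIntegral_closedBall_const_mul_frob (u : ℝ → ℝ³ → ℝ³) (k ρ s : ℝ) :
    ∫ y in closedBall (0 : ℝ³) ρ, k * frobeniusNormSq (fderiv ℝ (lerayOrbit u s) y) =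
      k * ∫ y in ball (0 : ℝ³) ρ, frobeniusNormSq (fderiv ℝ (lerayOrbit u s) y) := by
  rw [integral_const_mul, setIntegral_congr_set (ball_ae_eq_closedBall' ρ)]

include hu in
/-- **Generic collar estimate**: if `|g| ≤ w · frob` pointwise with a continuous weight `w ≥ 0`
vanishing off `closedBall 0 (2R)` and bounded by `m` there, then `|∫ g| ≤ m · E(2R)`. -/
theorem abs_integral_le_of_weight {g w : ℝ³ → ℝ} {R m : ℝ} (s : ℝ) (hw : Continuous w)
    (hw0 : ∀ y ∉ closedBall (0 : ℝ³) (2 * R), w y = 0) (hwm : ∀ y ∈ closedBall (0 : ℝ³) (2 * R), w y ≤ m)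
    (hg : ∀ y, |g y| ≤ w y * frobeniusNormSq (fderiv ℝ (lerayOrbit u s) y)) :
    |∫ y, g y| ≤ m * ∫ y in ball (0 : ℝ³) (2 * R), frobeniusNormSq (fderiv ℝ (lerayOrbit u s) y) := by
  set F : ℝ³ → ℝ := fun y => frobeniusNormSq (fderiv ℝ (lerayOrbit u s) y) with hF
  have hFc : Continuous F := continuous_frobeniusNormSq_fderiv_lerayOrbit hu s
  have hF0 : ∀ y, 0 ≤ F y := fun y => frobeniusNormSq_nonneg _
  -- the majorant `w · F` is integrable (continuous, vanishes off the closed ball)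
  have hG0 : ∀ y ∉ closedBall (0 : ℝ³) (2 * R), w y * F y = 0 := fun y hy => by rw [hw0 y hy, zero_mul]
  have hGi : Integrable fun y => w y * F y := integrable_of_continuous_of_eq_zero (hw.mul hFc) hG0
  have h1 : |∫ y, g y| ≤ ∫ y, w y * F y := by
    have := norm_integral_le_of_norm_le hGi (Eventually.of_forall fun y => by
      rw [Real.norm_eq_abs]; exact hg y)
    simpa only [Real.norm_eq_abs] using this
  have h2 : (∫ y, w y * F y) = ∫ y in closedBall (0 : ℝ³) (2 * R), w y * F y :=
    (setIntegral_eq_integral_of_forall_compl_eq_zero hG0).symm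
  have hmi : IntegrableOn (fun y => m * F y) (closedBall (0 : ℝ³) (2 * R)) :=
    ((continuous_const.mul hFc).continuousOn).integrableOn_compact (isCompact_closedBall _ _)
  have h3 : (∫ y in closedBall (0 : ℝ³) (2 * R), w y * F y) ≤
      ∫ y in closedBall (0 : ℝ³) (2 * R), m * F y :=
    setIntegral_mono_on hGi.integrableOn hmi measurableSet_closedBall fun y hy =>
      mul_le_mul_of_nonneg_right (hwm y hy) (hF0 y)
  rw [setIntegral_closedBall_const_mul_frob u] at h3
  linarith

include hu in
/-- **Cubic (null-Lagrangian) flux**: `|∫ φ_R det DU| ≤ ½ C (c₁/R) E(2R)`. -/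
theorem cubic_flux_le (hUC : ∀ (s : ℝ) (y : ℝ³), ‖lerayOrbit u s y‖ ≤ C) {c₁ : ℝ}
    (hc₁ : ∀ R : ℝ, 0 < R → ∀ y : ℝ³,
      ‖fderiv ℝ (fun z : ℝ³ => smoothTransition (2 - ‖z‖ ^ 2 / R ^ 2)) y‖ ≤ c₁ / R)
    {R : ℝ} (hR : 0 < R) (s : ℝ) :
    |∫ y, smoothTransition (2 - ‖y‖ ^ 2 / R ^ 2) *
        LinearMap.det (fderiv ℝ (lerayOrbit u s) y : ℝ³ →ₗ[ℝ] ℝ³)| ≤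
      (1 / 2) * C * (c₁ / R) * ∫ y in ball (0 : ℝ³) (2 * R), frobeniusNormSq (fderiv ℝ (lerayOrbit u s) y) := by
  have hC : 0 ≤ C := hu.nonneg
  set φ : ℝ³ → ℝ := fun z => smoothTransition (2 - ‖z‖ ^ 2 / R ^ 2) with hφdef
  have hφ : ContDiff ℝ ∞ φ := contDiff_smoothTransition_cutoff (n := ⊤) R
  have hφ1 : ContDiff ℝ 1 φ := contDiff_smoothTransition_cutoff (n := 1) R
  have hφc : HasCompactSupport φ := hasCompactSupport_smoothTransition_cutoff hR
  have hU : ContDiff ℝ ∞ (lerayOrbit u s) := contDiff_lerayOrbit_slice hu s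
  have hUd : ∀ y, DifferentiableAt ℝ (lerayOrbit u s) y := fun y =>
    (contDiff_lerayOrbit_slice hu s (n := 1)).differentiable one_ne_zero y
  rw [show (fun y => smoothTransition (2 - ‖y‖ ^ 2 / R ^ 2) *
      LinearMap.det (fderiv ℝ (lerayOrbit u s) y : ℝ³ →ₗ[ℝ] ℝ³)) = fun y => φ y *
      LinearMap.det (fderiv ℝ (lerayOrbit u s) y : ℝ³ →ₗ[ℝ] ℝ³) from rfl,
    integral_mul_det_fderiv_eq hU hφ hφc, abs_neg]
  -- weight `w = ½ C ‖Dφ‖`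
  refine abs_integral_le_of_weight hu s (w := fun y => (1 / 2) * C * ‖fderiv ℝ φ y‖)
    (continuous_const.mul (hφ1.continuous_fderiv one_ne_zero).norm) (fun y hy => ?_) (fun y _ => ?_)
    (fun y => ?_)
  · show (1 / 2) * C * ‖fderiv ℝ φ y‖ = 0
    rw [hφdef, fderiv_cutoff_eq_zero hR hy, norm_zero, mul_zero]
  · show (1 / 2) * C * ‖fderiv ℝ φ y‖ ≤ (1 / 2) * C * (c₁ / R)
    exact mul_le_mul_of_nonneg_left (hc₁ R hR y) (by positivity)
  · calc |lerayOrbit u s y 0 * ⟪cross (gradient (fun z => lerayOrbit u s z 1) y)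
          (gradient (fun z => lerayOrbit u s z 2) y), gradient φ y⟫|
        ≤ (1 / 2) * ‖lerayOrbit u s y‖ * ‖gradient φ y‖ * frobeniusNormSq (fderiv ℝ (lerayOrbit u s) y) :=
          abs_mul_inner_cross_gradient_le (hUd y) φ
      _ ≤ (1 / 2) * C * ‖fderiv ℝ φ y‖ * frobeniusNormSq (fderiv ℝ (lerayOrbit u s) y) := by
          rw [norm_gradient_eq]
          have hf0 : 0 ≤ frobeniusNormSq (fderiv ℝ (lerayOrbit u s) y) := frobeniusNormSq_nonneg _
          have hn0 : 0 ≤ ‖fderiv ℝ φ y‖ := norm_nonneg _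
          have := hUC s y
          gcongr

include hu in
/-- **Transport flux**: `|∫ (U·∇φ_R) ‖Ω‖²| ≤ 2 C (c₁/R) E(2R)`. -/
theorem transport_flux_le (hUC : ∀ (s : ℝ) (y : ℝ³), ‖lerayOrbit u s y‖ ≤ C) {c₁ : ℝ}
    (hc₁ : ∀ R : ℝ, 0 < R → ∀ y : ℝ³,
      ‖fderiv ℝ (fun z : ℝ³ => smoothTransition (2 - ‖z‖ ^ 2 / R ^ 2)) y‖ ≤ c₁ / R)
    {R : ℝ} (hR : 0 < R) (s : ℝ) :
    |∫ y, fderiv ℝ (fun z : ℝ³ => smoothTransition (2 - ‖z‖ ^ 2 / R ^ 2)) y (lerayOrbit u s y) *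
        ‖lerayVorticity u s y‖ ^ 2| ≤
      2 * C * (c₁ / R) * ∫ y in ball (0 : ℝ³) (2 * R), frobeniusNormSq (fderiv ℝ (lerayOrbit u s) y) := by
  have hC : 0 ≤ C := hu.nonneg
  set φ : ℝ³ → ℝ := fun z => smoothTransition (2 - ‖z‖ ^ 2 / R ^ 2) with hφdef
  have hφ1 : ContDiff ℝ 1 φ := contDiff_smoothTransition_cutoff (n := 1) R
  refine abs_integral_le_of_weight hu s (w := fun y => 2 * C * ‖fderiv ℝ φ y‖)
    (continuous_const.mul (hφ1.continuous_fderiv one_ne_zero).norm) (fun y hy => ?_) (fun y _ => ?_)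
    (fun y => ?_)
  · show 2 * C * ‖fderiv ℝ φ y‖ = 0
    rw [hφdef, fderiv_cutoff_eq_zero hR hy, norm_zero, mul_zero]
  · show 2 * C * ‖fderiv ℝ φ y‖ ≤ 2 * C * (c₁ / R)
    exact mul_le_mul_of_nonneg_left (hc₁ R hR y) (by positivity)
  · have h1 : |fderiv ℝ φ y (lerayOrbit u s y)| ≤ ‖fderiv ℝ φ y‖ * C := by
      rw [← Real.norm_eq_abs]
      exact (ContinuousLinearMap.le_opNorm _ _).trans
        (mul_le_mul_of_nonneg_left (hUC s y) (norm_nonneg _))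
    have h2 : ‖lerayVorticity u s y‖ ^ 2 ≤ 2 * frobeniusNormSq (fderiv ℝ (lerayOrbit u s) y) := by
      rw [lerayVorticity_apply]; exact norm_curl_sq_le_two_mul_frobeniusNormSq _ _
    rw [abs_mul, abs_of_nonneg (sq_nonneg ‖lerayVorticity u s y‖)]
    have hn0 : 0 ≤ ‖fderiv ℝ φ y‖ * C := by positivity
    calc |fderiv ℝ φ y (lerayOrbit u s y)| * ‖lerayVorticity u s y‖ ^ 2
        ≤ (‖fderiv ℝ φ y‖ * C) * (2 * frobeniusNormSq (fderiv ℝ (lerayOrbit u s) y)) :=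
          mul_le_mul h1 h2 (sq_nonneg _) hn0
      _ = 2 * C * ‖fderiv ℝ φ y‖ * frobeniusNormSq (fderiv ℝ (lerayOrbit u s) y) := by ring

include hu in
/-- **Viscous flux**: `|∫ ‖Ω‖² Δφ_R| ≤ 2 (c₂/R²) E(2R)`. -/
theorem viscous_flux_le {c₂ : ℝ}
    (hc₂ : ∀ R : ℝ, 0 < R → ∀ y : ℝ³,
      |(Δ (fun z : ℝ³ => smoothTransition (2 - ‖z‖ ^ 2 / R ^ 2))) y| ≤ c₂ / R ^ 2)
    {R : ℝ} (hR : 0 < R) (s : ℝ) :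
    |∫ y, ‖lerayVorticity u s y‖ ^ 2 * (Δ (fun z : ℝ³ => smoothTransition (2 - ‖z‖ ^ 2 / R ^ 2))) y| ≤
      2 * (c₂ / R ^ 2) * ∫ y in ball (0 : ℝ³) (2 * R), frobeniusNormSq (fderiv ℝ (lerayOrbit u s) y) := by
  set φ : ℝ³ → ℝ := fun z => smoothTransition (2 - ‖z‖ ^ 2 / R ^ 2) with hφdef
  have hφ2 : ContDiff ℝ 2 φ := contDiff_smoothTransition_cutoff (n := 2) R
  refine abs_integral_le_of_weight hu s (w := fun y => 2 * |(Δ φ) y|)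
    (continuous_const.mul (continuous_laplacian hφ2).abs) (fun y hy => ?_) (fun y _ => ?_)
    (fun y => ?_)
  · show 2 * |(Δ φ) y| = 0
    rw [hφdef, laplacian_cutoff_eq_zero hR hy, abs_zero, mul_zero]
  · show 2 * |(Δ φ) y| ≤ 2 * (c₂ / R ^ 2)
    exact mul_le_mul_of_nonneg_left (hc₂ R hR y) zero_le_two
  · have h2 : ‖lerayVorticity u s y‖ ^ 2 ≤ 2 * frobeniusNormSq (fderiv ℝ (lerayOrbit u s) y) := by
      rw [lerayVorticity_apply]; exact norm_curl_sq_le_two_mul_frobeniusNormSq _ _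
    rw [abs_mul, abs_of_nonneg (sq_nonneg ‖lerayVorticity u s y‖)]
    have ha0 : 0 ≤ |(Δ φ) y| := abs_nonneg _
    calc ‖lerayVorticity u s y‖ ^ 2 * |(Δ φ) y|
        ≤ (2 * frobeniusNormSq (fderiv ℝ (lerayOrbit u s) y)) * |(Δ φ) y| :=
          mul_le_mul_of_nonneg_right h2 ha0
      _ = 2 * |(Δ φ) y| * frobeniusNormSq (fderiv ℝ (lerayOrbit u s) y) := by ring

/-- **Drift flux sign**: `∫ (y·∇φ_R) ‖Ω‖² ≤ 0` (ray monotonicity of the cutoff). -/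
theorem drift_flux_nonpos (u : ℝ → ℝ³ → ℝ³) (R s : ℝ) :
    (∫ y, fderiv ℝ (fun z : ℝ³ => smoothTransition (2 - ‖z‖ ^ 2 / R ^ 2)) y y *
        ‖lerayVorticity u s y‖ ^ 2) ≤ 0 :=
  integral_nonpos fun y => mul_nonpos_of_nonpos_of_nonneg
    (fderiv_smoothTransition_cutoff_self_nonpos R y) (sq_nonneg _)

end Flux

/-! ## The integrated production bound -/

/-- **`∫ φ ⟪DU Ω, Ω⟫ ≤ 4 ∫ φ det DU + a (2 ∫ φ ‖DU‖²_F − Z)`** (integrate `production_pointwise`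
against the nonnegative cutoff). -/
theorem production_integral_le (hu : IsTypeIAncientMild C u)
    (hΛ : ∀ t < 0, ∀ x, lerayMiddleStrain u t x ≤ a) (ha : 0 ≤ a) {R : ℝ} (hR : 0 < R) (s : ℝ) :
    (∫ y, smoothTransition (2 - ‖y‖ ^ 2 / R ^ 2) *
        ⟪fderiv ℝ (lerayOrbit u s) y (lerayVorticity u s y), lerayVorticity u s y⟫) ≤
      4 * (∫ y, smoothTransition (2 - ‖y‖ ^ 2 / R ^ 2) *
          LinearMap.det (fderiv ℝ (lerayOrbit u s) y : ℝ³ →ₗ[ℝ] ℝ³)) +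
        a * (2 * (∫ y, smoothTransition (2 - ‖y‖ ^ 2 / R ^ 2) * frobeniusNormSq (fderiv ℝ (lerayOrbit u s) y)) -
          ∫ y, smoothTransition (2 - ‖y‖ ^ 2 / R ^ 2) * ‖lerayVorticity u s y‖ ^ 2) := by
  set φ : ℝ³ → ℝ := fun z => smoothTransition (2 - ‖z‖ ^ 2 / R ^ 2) with hφdef
  have hφc : HasCompactSupport φ := hasCompactSupport_smoothTransition_cutoff hR
  have hφcont : Continuous φ := (contDiff_smoothTransition_cutoff (n := 0) R).continuous
  have hφ0 : ∀ y, 0 ≤ φ y := fun y => smoothTransition_cutoff_nonneg R y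
  have hcDU : Continuous (fderiv ℝ (lerayOrbit u s)) :=
    (contDiff_lerayOrbit_slice hu s (n := 1)).continuous_fderiv one_ne_zero
  have hcΩ : Continuous (lerayVorticity u s) := continuous_lerayVorticity hu s
  have hcF : Continuous fun y => frobeniusNormSq (fderiv ℝ (lerayOrbit u s) y) :=
    continuous_frobeniusNormSq_fderiv_lerayOrbit hu s
  have hcdet : Continuous fun y => LinearMap.det (fderiv ℝ (lerayOrbit u s) y : ℝ³ →ₗ[ℝ] ℝ³) :=
    ContinuousLinearMap.continuous_det.comp hcDU
  have hcP : Continuous fun y => ⟪fderiv ℝ (lerayOrbit u s) y (lerayVorticity u s y), lerayVorticity u s y⟫ :=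
    (hcDU.clm_apply hcΩ).inner hcΩ
  -- integrability (continuous × compactly supported cutoff)
  have iP : Integrable fun y => φ y * ⟪fderiv ℝ (lerayOrbit u s) y (lerayVorticity u s y), lerayVorticity u s y⟫ :=
    (hφcont.mul hcP).integrable_of_hasCompactSupport hφc.mul_right
  have idet : Integrable fun y => φ y * LinearMap.det (fderiv ℝ (lerayOrbit u s) y : ℝ³ →ₗ[ℝ] ℝ³) :=
    (hφcont.mul hcdet).integrable_of_hasCompactSupport hφc.mul_right
  have iF : Integrable fun y => φ y * frobeniusNormSq (fderiv ℝ (lerayOrbit u s) y) :=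
    (hφcont.mul hcF).integrable_of_hasCompactSupport hφc.mul_right
  have iZ : Integrable fun y => φ y * ‖lerayVorticity u s y‖ ^ 2 :=
    (hφcont.mul (hcΩ.norm.pow 2)).integrable_of_hasCompactSupport hφc.mul_right
  have iG : Integrable fun y => 4 * (φ y * LinearMap.det (fderiv ℝ (lerayOrbit u s) y : ℝ³ →ₗ[ℝ] ℝ³)) +
      a * (2 * (φ y * frobeniusNormSq (fderiv ℝ (lerayOrbit u s) y)) - φ y * ‖lerayVorticity u s y‖ ^ 2) :=
    (idet.const_mul 4).add (((iF.const_mul 2).sub iZ).const_mul a)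
  -- pointwise
  have hpt : ∀ y, φ y * ⟪fderiv ℝ (lerayOrbit u s) y (lerayVorticity u s y), lerayVorticity u s y⟫ ≤
      4 * (φ y * LinearMap.det (fderiv ℝ (lerayOrbit u s) y : ℝ³ →ₗ[ℝ] ℝ³)) +
        a * (2 * (φ y * frobeniusNormSq (fderiv ℝ (lerayOrbit u s) y)) - φ y * ‖lerayVorticity u s y‖ ^ 2) := by
    intro y
    have h := mul_le_mul_of_nonneg_left (production_pointwise hu hΛ ha s y) (hφ0 y)
    have e : φ y * (4 * LinearMap.det (fderiv ℝ (lerayOrbit u s) y : ℝ³ →ₗ[ℝ] ℝ³) +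
        a * (2 * frobeniusNormSq (fderiv ℝ (lerayOrbit u s) y) - ‖lerayVorticity u s y‖ ^ 2)) =
        4 * (φ y * LinearMap.det (fderiv ℝ (lerayOrbit u s) y : ℝ³ →ₗ[ℝ] ℝ³)) +
          a * (2 * (φ y * frobeniusNormSq (fderiv ℝ (lerayOrbit u s) y)) - φ y * ‖lerayVorticity u s y‖ ^ 2) := by
      ring
    rw [e] at h
    exact h
  have hmono := integral_mono iP iG hpt
  have i1 : Integrable fun y => 4 * (φ y * LinearMap.det (fderiv ℝ (lerayOrbit u s) y : ℝ³ →ₗ[ℝ] ℝ³)) :=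
    idet.const_mul 4
  have i23 : Integrable fun y => 2 * (φ y * frobeniusNormSq (fderiv ℝ (lerayOrbit u s) y)) -
      φ y * ‖lerayVorticity u s y‖ ^ 2 := (iF.const_mul 2).sub iZ
  have i2 : Integrable fun y => a * (2 * (φ y * frobeniusNormSq (fderiv ℝ (lerayOrbit u s) y)) -
      φ y * ‖lerayVorticity u s y‖ ^ 2) := i23.const_mul a
  have eA : (∫ y, 4 * (φ y * LinearMap.det (fderiv ℝ (lerayOrbit u s) y : ℝ³ →ₗ[ℝ] ℝ³)) +
      a * (2 * (φ y * frobeniusNormSq (fderiv ℝ (lerayOrbit u s) y)) - φ y * ‖lerayVorticity u s y‖ ^ 2)) =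
      (∫ y, 4 * (φ y * LinearMap.det (fderiv ℝ (lerayOrbit u s) y : ℝ³ →ₗ[ℝ] ℝ³))) +
        ∫ y, a * (2 * (φ y * frobeniusNormSq (fderiv ℝ (lerayOrbit u s) y)) - φ y * ‖lerayVorticity u s y‖ ^ 2) :=
    integral_add i1 i2
  have eB : (∫ y, 4 * (φ y * LinearMap.det (fderiv ℝ (lerayOrbit u s) y : ℝ³ →ₗ[ℝ] ℝ³))) =
      4 * ∫ y, φ y * LinearMap.det (fderiv ℝ (lerayOrbit u s) y : ℝ³ →ₗ[ℝ] ℝ³) :=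
    integral_const_mul _ _
  have eC : (∫ y, a * (2 * (φ y * frobeniusNormSq (fderiv ℝ (lerayOrbit u s) y)) - φ y * ‖lerayVorticity u s y‖ ^ 2)) =
      a * ∫ y, (2 * (φ y * frobeniusNormSq (fderiv ℝ (lerayOrbit u s) y)) - φ y * ‖lerayVorticity u s y‖ ^ 2) :=
    integral_const_mul _ _
  have eD : (∫ y, (2 * (φ y * frobeniusNormSq (fderiv ℝ (lerayOrbit u s) y)) - φ y * ‖lerayVorticity u s y‖ ^ 2)) =
      (∫ y, 2 * (φ y * frobeniusNormSq (fderiv ℝ (lerayOrbit u s) y))) - ∫ y, φ y * ‖lerayVorticity u s y‖ ^ 2 :=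
    integral_sub (iF.const_mul 2) iZ
  have eE : (∫ y, 2 * (φ y * frobeniusNormSq (fderiv ℝ (lerayOrbit u s) y))) =
      2 * ∫ y, φ y * frobeniusNormSq (fderiv ℝ (lerayOrbit u s) y) :=
    integral_const_mul _ _
  have hsum : (∫ y, 4 * (φ y * LinearMap.det (fderiv ℝ (lerayOrbit u s) y : ℝ³ →ₗ[ℝ] ℝ³)) +
      a * (2 * (φ y * frobeniusNormSq (fderiv ℝ (lerayOrbit u s) y)) - φ y * ‖lerayVorticity u s y‖ ^ 2)) =
      4 * (∫ y, φ y * LinearMap.det (fderiv ℝ (lerayOrbit u s) y : ℝ³ →ₗ[ℝ] ℝ³)) +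
        a * (2 * (∫ y, φ y * frobeniusNormSq (fderiv ℝ (lerayOrbit u s) y)) -
          ∫ y, φ y * ‖lerayVorticity u s y‖ ^ 2) := by
    rw [eA, eB, eC, eD, eE]
  rw [hsum] at hmono
  exact hmono

/-! ## Assembly: the static half of `stub_signedBudget` -/

/-- **The lever without the time derivative.**  For `R ≥ 1` put
`K s := κ₀ E(2R,s)/R + 4aκ'⁺ √(E(2R,s)/R)`, `κ₀ = 6 C c₁ + 2 c₂`.  Then `K` is continuous,
nonnegative, `K ≤ κ (E/R + √(E/R))` with `κ = max κ₀ (4aκ'⁺)`, and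
`−½Z + ½∫(y·∇φ)‖Ω‖² + ∫(U·∇φ)‖Ω‖² + 2∫φ⟪DUΩ,Ω⟫ + ∫‖Ω‖²Δφ ≤ −2(¼ − a) Z + K`.
The left side is `Z' + 2∫φ‖∇Ω‖²_F` by the similarity vorticity equation and the three
`WholeSpaceIBPEnstrophy` identities (the lead's remaining step). -/
theorem lever_static_bound (C a κ' : ℝ) (u : ℝ → ℝ³ → ℝ³) (hu : IsTypeIAncientMild C u)
    (hΛ : ∀ t < 0, ∀ x, lerayMiddleStrain u t x ≤ a) (ha : 0 ≤ a)
    (hUC : ∀ (s : ℝ) (y : ℝ³), ‖lerayOrbit u s y‖ ≤ C)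
    (hEcont : ∀ ρ : ℝ, 0 < ρ →
      Continuous fun s => ∫ y in Metric.ball (0 : ℝ³) ρ, frobeniusNormSq (fderiv ℝ (lerayOrbit u s) y))
    (hcmp : ∀ (R s : ℝ), 1 ≤ R →
      (∫ y, smoothTransition (2 - ‖y‖ ^ 2 / R ^ 2) * frobeniusNormSq (fderiv ℝ (lerayOrbit u s) y)) ≤
        (∫ y, smoothTransition (2 - ‖y‖ ^ 2 / R ^ 2) * ‖lerayVorticity u s y‖ ^ 2) +
          κ' * Real.sqrt ((∫ y in Metric.ball (0 : ℝ³) (2 * R),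
            frobeniusNormSq (fderiv ℝ (lerayOrbit u s) y)) / R)) :
    ∃ κ : ℝ, ∀ R : ℝ, 1 ≤ R →
      ∃ K : ℝ → ℝ, Continuous K ∧ (∀ s, 0 ≤ K s) ∧
        (∀ s, K s ≤ κ * ((∫ y in Metric.ball (0 : ℝ³) (2 * R), frobeniusNormSq (fderiv ℝ (lerayOrbit u s) y)) / R +
          Real.sqrt ((∫ y in Metric.ball (0 : ℝ³) (2 * R), frobeniusNormSq (fderiv ℝ (lerayOrbit u s) y)) / R))) ∧
        ∀ s, -(1 / 2) * (∫ y, smoothTransition (2 - ‖y‖ ^ 2 / R ^ 2) * ‖lerayVorticity u s y‖ ^ 2)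
            + (1 / 2) * (∫ y, fderiv ℝ (fun z : ℝ³ => smoothTransition (2 - ‖z‖ ^ 2 / R ^ 2)) y y *
                ‖lerayVorticity u s y‖ ^ 2)
            + (∫ y, fderiv ℝ (fun z : ℝ³ => smoothTransition (2 - ‖z‖ ^ 2 / R ^ 2)) y (lerayOrbit u s y) *
                ‖lerayVorticity u s y‖ ^ 2)
            + 2 * (∫ y, smoothTransition (2 - ‖y‖ ^ 2 / R ^ 2) *
                ⟪fderiv ℝ (lerayOrbit u s) y (lerayVorticity u s y), lerayVorticity u s y⟫)
            + (∫ y, ‖lerayVorticity u s y‖ ^ 2 *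
                (Δ (fun z : ℝ³ => smoothTransition (2 - ‖z‖ ^ 2 / R ^ 2))) y)
          ≤ -(2 * (1 / 4 - a)) * (∫ y, smoothTransition (2 - ‖y‖ ^ 2 / R ^ 2) * ‖lerayVorticity u s y‖ ^ 2)
              + K s := by
  obtain ⟨c₁, hc₁0, hc₁⟩ := exists_norm_fderiv_smoothTransition_cutoff_le (E := ℝ³)
  obtain ⟨c₂, hc₂0, hc₂⟩ := exists_abs_laplacian_smoothTransition_cutoff_le (E := ℝ³)
  have hC : 0 ≤ C := hu.nonneg
  have hk0 : 0 ≤ max κ' 0 := le_max_right _ _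
  refine ⟨max (6 * C * c₁ + 2 * c₂) (4 * a * max κ' 0), fun R hR1 => ?_⟩
  have hR : 0 < R := lt_of_lt_of_le one_pos hR1
  -- the forcing
  refine ⟨fun s => (6 * C * c₁ + 2 * c₂) *
      ((∫ y in Metric.ball (0 : ℝ³) (2 * R), frobeniusNormSq (fderiv ℝ (lerayOrbit u s) y)) / R) +
      4 * a * max κ' 0 *
        Real.sqrt ((∫ y in Metric.ball (0 : ℝ³) (2 * R), frobeniusNormSq (fderiv ℝ (lerayOrbit u s) y)) / R),
    ?_, ?_, ?_, ?_⟩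
  · -- continuity
    have hE := hEcont (2 * R) (by positivity)
    exact ((hE.div_const R).const_mul _).add ((hE.div_const R).sqrt.const_mul _)
  · -- nonnegativity
    intro s
    have hE0 := ballGradEnergy_nonneg u (2 * R) s
    positivity
  · -- comparison with `κ (E/R + √(E/R))`
    intro s
    set X : ℝ := (∫ y in Metric.ball (0 : ℝ³) (2 * R), frobeniusNormSq (fderiv ℝ (lerayOrbit u s) y)) / R
    have hX : 0 ≤ X := div_nonneg (ballGradEnergy_nonneg u (2 * R) s) hR.le
    have hS : 0 ≤ Real.sqrt X := Real.sqrt_nonneg _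
    rw [mul_add]
    exact add_le_add (mul_le_mul_of_nonneg_right (le_max_left _ _) hX)
      (mul_le_mul_of_nonneg_right (le_max_right _ _) hS)
  · -- the inequality
    intro s
    beta_reduce
    set Z : ℝ := ∫ y, smoothTransition (2 - ‖y‖ ^ 2 / R ^ 2) * ‖lerayVorticity u s y‖ ^ 2 with hZ
    set E2 : ℝ := ∫ y in Metric.ball (0 : ℝ³) (2 * R), frobeniusNormSq (fderiv ℝ (lerayOrbit u s) y) with hE2
    set Idet : ℝ := ∫ y, smoothTransition (2 - ‖y‖ ^ 2 / R ^ 2) *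
        LinearMap.det (fderiv ℝ (lerayOrbit u s) y : ℝ³ →ₗ[ℝ] ℝ³) with hIdet
    set Ifrob : ℝ := ∫ y, smoothTransition (2 - ‖y‖ ^ 2 / R ^ 2) *
        frobeniusNormSq (fderiv ℝ (lerayOrbit u s) y) with hIfrob
    set P : ℝ := ∫ y, smoothTransition (2 - ‖y‖ ^ 2 / R ^ 2) *
        ⟪fderiv ℝ (lerayOrbit u s) y (lerayVorticity u s y), lerayVorticity u s y⟫ with hP
    set D : ℝ := ∫ y, fderiv ℝ (fun z : ℝ³ => smoothTransition (2 - ‖z‖ ^ 2 / R ^ 2)) y y *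
        ‖lerayVorticity u s y‖ ^ 2 with hD
    set T : ℝ := ∫ y, fderiv ℝ (fun z : ℝ³ => smoothTransition (2 - ‖z‖ ^ 2 / R ^ 2)) y (lerayOrbit u s y) *
        ‖lerayVorticity u s y‖ ^ 2 with hT
    set V : ℝ := ∫ y, ‖lerayVorticity u s y‖ ^ 2 *
        (Δ (fun z : ℝ³ => smoothTransition (2 - ‖z‖ ^ 2 / R ^ 2))) y with hV
    set S : ℝ := Real.sqrt (E2 / R) with hS
    have hE0 : 0 ≤ E2 := ballGradEnergy_nonneg u (2 * R) s
    have hX0 : 0 ≤ E2 / R := div_nonneg hE0 hR.le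
    have hS0 : 0 ≤ S := Real.sqrt_nonneg _
    -- the five estimates
    have h1 : Idet ≤ (1 / 2) * (C * c₁ * (E2 / R)) := by
      have h := (abs_le.1 (cubic_flux_le hu hUC hc₁ hR s)).2
      have e : (1 / 2) * C * (c₁ / R) * E2 = (1 / 2) * (C * c₁ * (E2 / R)) := by ring
      linarith
    have h2 : T ≤ 2 * (C * c₁ * (E2 / R)) := by
      have h := (abs_le.1 (transport_flux_le hu hUC hc₁ hR s)).2
      have e : 2 * C * (c₁ / R) * E2 = 2 * (C * c₁ * (E2 / R)) := by ring
      linarith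
    have h3 : V ≤ 2 * (c₂ * (E2 / R)) := by
      have h := (abs_le.1 (viscous_flux_le hu hc₂ hR s)).2
      have hRR : c₂ / R ^ 2 ≤ c₂ / R :=
        div_le_div_of_nonneg_left hc₂0 hR (by nlinarith)
      have e : 2 * (c₂ / R) * E2 = 2 * (c₂ * (E2 / R)) := by ring
      nlinarith
    have h4 : D ≤ 0 := drift_flux_nonpos u R s
    have h5 : P ≤ 4 * Idet + 2 * (a * Ifrob) - a * Z := by
      have h := production_integral_le hu hΛ ha hR s
      have e : a * (2 * Ifrob - Z) = 2 * (a * Ifrob) - a * Z := by ring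
      linarith
    have h6 : a * Ifrob ≤ a * Z + a * (max κ' 0 * S) := by
      have hc := hcmp R s hR1
      have hκ : κ' * S ≤ max κ' 0 * S := mul_le_mul_of_nonneg_right (le_max_left _ _) hS0
      have hI : Ifrob ≤ Z + max κ' 0 * S := by linarith
      have h := mul_le_mul_of_nonneg_left hI ha
      have e : a * (Z + max κ' 0 * S) = a * Z + a * (max κ' 0 * S) := by ring
      linarith
    -- normalise the target and close linearly
    have eZ : -(2 * (1 / 4 - a)) * Z = -(1 / 2) * Z + 2 * (a * Z) := by ring
    have eK : (6 * C * c₁ + 2 * c₂) * (E2 / R) + 4 * a * max κ' 0 * S =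
        6 * (C * c₁ * (E2 / R)) + 2 * (c₂ * (E2 / R)) + 4 * (a * (max κ' 0 * S)) := by ring
    rw [eZ, eK]
    linarith

/-! ## The dynamic half: `Z_R` is differentiable and `Z_R' = −½Z + ½D + T + 2P + V − 2∫φ‖∇Ω‖²_F` -/

section Dynamic

variable (hu : IsTypeIAncientMild C u)
include hu

/-- The similarity vorticity is jointly smooth in `(s, y)`. -/
theorem contDiff_uncurry_lerayVorticity : ContDiff ℝ ∞ (Function.uncurry (lerayVorticity u)) := by
  have hU : ContDiff ℝ ∞ (Function.uncurry (lerayOrbit u)) := contDiff_uncurry_lerayOrbit hu.1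
  have hU' : ContDiff ℝ ∞ (Function.uncurry fun (p : ℝ × ℝ³) (q : ℝ³) => lerayOrbit u p.1 q) := by
    have e : (Function.uncurry fun (p : ℝ × ℝ³) (q : ℝ³) => lerayOrbit u p.1 q) =
        Function.uncurry (lerayOrbit u) ∘ fun r : (ℝ × ℝ³) × ℝ³ => (r.1.1, r.2) := by
      funext r; rfl
    rw [e]
    exact hU.comp ((contDiff_fst.comp contDiff_fst).prodMk contDiff_snd)
  have hD : ContDiff ℝ ∞ fun p : ℝ × ℝ³ => fderiv ℝ (lerayOrbit u p.1) p.2 :=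
    hU'.fderiv (m := ∞) (n := ∞) contDiff_snd (by simp)
  have e : Function.uncurry (lerayVorticity u) = fun p : ℝ × ℝ³ => curlCLM (fderiv ℝ (lerayOrbit u p.1) p.2) := by
    funext p; rfl
  rw [e]
  exact curlCLM.contDiff.comp hD

/-- Joint smoothness in the `ContDiffOn … (univ ×ˢ univ)` form of `SpaceTimeCalculusC1`. -/
theorem contDiffOn_uncurry_lerayVorticity {n : ℕ∞} :
    ContDiffOn ℝ n (Function.uncurry (lerayVorticity u)) (univ ×ˢ univ) :=
  ((contDiff_uncurry_lerayVorticity hu).of_le (by exact_mod_cast le_top)).contDiffOn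

/-- Slices of the similarity vorticity are smooth. -/
theorem contDiff_lerayVorticity_slice (s : ℝ) {n : ℕ∞} : ContDiff ℝ n (lerayVorticity u s) :=
  contDiff_slice_of_contDiffOn (contDiffOn_uncurry_lerayVorticity hu) (mem_univ s)

/-- **The time derivative of the localised enstrophy** (differentiation under the integral sign
for the jointly smooth, compactly cut-off integrand):
`Z_R'(s) = ∫ φ_R · 2⟪∂ₛΩ(s,·), Ω(s,·)⟫`, `∂ₛΩ = timeDerivWithin univ (lerayVorticity u)`. -/
theorem hasDerivAt_cutoffEnstrophy {R : ℝ} (hR : 0 < R) (s : ℝ) :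
    HasDerivAt (fun σ => ∫ y, smoothTransition (2 - ‖y‖ ^ 2 / R ^ 2) * ‖lerayVorticity u σ y‖ ^ 2)
      (∫ y, smoothTransition (2 - ‖y‖ ^ 2 / R ^ 2) *
        (2 * ⟪timeDerivWithin univ (lerayVorticity u) s y, lerayVorticity u s y⟫)) s := by
  have hφ : ContDiff ℝ 1 fun z : ℝ³ => smoothTransition (2 - ‖z‖ ^ 2 / R ^ 2) :=
    contDiff_smoothTransition_cutoff (n := 1) R
  have hΦ : ContDiffOn ℝ 1 (Function.uncurry fun (σ : ℝ) (y : ℝ³) =>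
      smoothTransition (2 - ‖y‖ ^ 2 / R ^ 2) * ‖lerayVorticity u σ y‖ ^ 2) (univ ×ˢ univ) := by
    have h1 : ContDiff ℝ 1 fun p : ℝ × ℝ³ => smoothTransition (2 - ‖p.2‖ ^ 2 / R ^ 2) :=
      hφ.comp contDiff_snd
    have h2 : ContDiff ℝ 1 fun p : ℝ × ℝ³ => ‖Function.uncurry (lerayVorticity u) p‖ ^ 2 :=
      ((contDiff_uncurry_lerayVorticity hu).of_le (by exact_mod_cast le_top)).norm_sq ℝ
    exact (h1.mul h2).contDiffOn
  have hsupp : ∀ t ∈ (univ : Set ℝ), ∀ y ∉ closedBall (0 : ℝ³) (2 * R),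
      (fun (σ : ℝ) (y : ℝ³) => smoothTransition (2 - ‖y‖ ^ 2 / R ^ 2) * ‖lerayVorticity u σ y‖ ^ 2) t y = 0 := by
    intro t _ y hy
    show smoothTransition (2 - ‖y‖ ^ 2 / R ^ 2) * ‖lerayVorticity u t y‖ ^ 2 = 0
    rw [smoothTransition_cutoff_eq_zero_of_notMem hR hy, zero_mul]
  have key := hasDerivAt_integral_of_contDiffOn (μ := (volume : Measure ℝ³)) isOpen_univ hΦ
    (isCompact_closedBall (0 : ℝ³) (2 * R)) hsupp (mem_univ s)
  -- the pointwise time derivative of the integrand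
  have hΩ1 : ContDiffOn ℝ 1 (Function.uncurry (lerayVorticity u)) (univ ×ˢ univ) :=
    contDiffOn_uncurry_lerayVorticity hu (n := 1)
  have hpt : ∀ y, deriv (fun σ => smoothTransition (2 - ‖y‖ ^ 2 / R ^ 2) * ‖lerayVorticity u σ y‖ ^ 2) s =
      smoothTransition (2 - ‖y‖ ^ 2 / R ^ 2) *
        (2 * ⟪timeDerivWithin univ (lerayVorticity u) s y, lerayVorticity u s y⟫) := by
    intro y
    have h1 := hasDerivAt_timeLine_timeDerivWithin hΩ1 univ_mem y (t := s)
    have h2 := (h1.norm_sq).const_mul (smoothTransition (2 - ‖y‖ ^ 2 / R ^ 2))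
    rw [h2.deriv, real_inner_comm]
  have e : (fun y => deriv (fun σ => (fun (σ : ℝ) (y : ℝ³) =>
      smoothTransition (2 - ‖y‖ ^ 2 / R ^ 2) * ‖lerayVorticity u σ y‖ ^ 2) σ y) s) =
      fun y => smoothTransition (2 - ‖y‖ ^ 2 / R ^ 2) *
        (2 * ⟪timeDerivWithin univ (lerayVorticity u) s y, lerayVorticity u s y⟫) :=
    funext hpt
  rw [e] at key
  exact key

omit hu in
/-- Inner-product bookkeeping for the five terms of the vorticity equation. -/
theorem inner_expand (c : ℝ) (a b w d e : ℝ³) :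
    c * (2 * ⟪a + b - w - (1 / 2 : ℝ) • d - e, w⟫) =
      2 * (c * ⟪a, w⟫) + 2 * (c * ⟪b, w⟫) - 2 * (c * ⟪w, w⟫) - c * ⟪d, w⟫ - 2 * (c * ⟪e, w⟫) := by
  rw [inner_sub_left, inner_sub_left, inner_sub_left, inner_add_left, real_inner_smul_left]
  ring

/-- **The enstrophy identity** at a fixed `s`, for any smooth compactly supported cutoff `φ`:
inserting the similarity vorticity equation and integrating by parts three times,
`∫ φ · 2⟪∂ₛΩ, Ω⟫ = −½∫φ‖Ω‖² + ½∫(y·∇φ)‖Ω‖² + ∫(U·∇φ)‖Ω‖² + 2∫φ⟪DUΩ,Ω⟫ + ∫‖Ω‖²Δφ − 2∫φ‖∇Ω‖²_F`. -/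
theorem enstrophy_identity {φ : ℝ³ → ℝ} (hφ : ContDiff ℝ ∞ φ) (hφc : HasCompactSupport φ) (s : ℝ) :
    (∫ y, φ y * (2 * ⟪timeDerivWithin univ (lerayVorticity u) s y, lerayVorticity u s y⟫)) =
      -(1 / 2) * (∫ y, φ y * ‖lerayVorticity u s y‖ ^ 2)
        + (1 / 2) * (∫ y, fderiv ℝ φ y y * ‖lerayVorticity u s y‖ ^ 2)
        + (∫ y, fderiv ℝ φ y (lerayOrbit u s y) * ‖lerayVorticity u s y‖ ^ 2)
        + 2 * (∫ y, φ y * ⟪fderiv ℝ (lerayOrbit u s) y (lerayVorticity u s y), lerayVorticity u s y⟫)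
        + (∫ y, ‖lerayVorticity u s y‖ ^ 2 * (Δ φ) y)
        - 2 * (∫ y, φ y * frobeniusNormSq (fderiv ℝ (lerayVorticity u s) y)) := by
  have hφcont : Continuous φ := hφ.continuous
  have hW : ContDiff ℝ ∞ (lerayVorticity u s) := contDiff_lerayVorticity_slice hu s (n := ⊤)
  have hU : ContDiff ℝ ∞ (lerayOrbit u s) := contDiff_lerayOrbit_slice hu s (n := ⊤)
  have hdiv : VectorCalculus.IsDivFree (lerayOrbit u s) :=
    (isDivFree_lerayOrbit_iff u s).2 (hu.isDivFree (neg_neg_of_pos (Real.exp_pos _)))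
  -- the three integrations by parts
  have ibp1 := two_mul_integral_mul_inner_fderiv_self_self_eq (φ := φ) (W := lerayVorticity u s) hφ hφc hW
  have ibp2 := two_mul_integral_mul_inner_convect_self_eq_of_isDivFree (φ := φ) (W := lerayVorticity u s)
    (V := lerayOrbit u s) hφ hφc hW hU hdiv
  have ibp3 := integral_mul_inner_laplacian_self_eq (φ := φ) (W := lerayVorticity u s) hφ hφc hW
  rw [finrank_euclideanSpace_fin] at ibp1
  simp only [Nat.cast_ofNat] at ibp1
  -- the PDE, solved for the time derivative
  have hpde : ∀ y, timeDerivWithin univ (lerayVorticity u) s y =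
      convect (lerayVorticity u s) (lerayOrbit u s) y + (Δ (lerayVorticity u s)) y - lerayVorticity u s y
        - (1 / 2 : ℝ) • fderiv ℝ (lerayVorticity u s) y y - convect (lerayOrbit u s) (lerayVorticity u s) y := by
    intro y
    have h := hu.lerayVorticity_eq s y
    rw [← h]
    abel
  -- continuity of the pieces
  have hcW : Continuous (lerayVorticity u s) := hW.continuous
  have hcU : Continuous (lerayOrbit u s) := hU.continuous
  have hcDW : Continuous (fderiv ℝ (lerayVorticity u s)) :=
    (contDiff_lerayVorticity_slice hu s (n := 1)).continuous_fderiv one_ne_zero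
  have hcDU : Continuous (fderiv ℝ (lerayOrbit u s)) :=
    (contDiff_lerayOrbit_slice hu s (n := 1)).continuous_fderiv one_ne_zero
  have hcΔ : Continuous (Δ (lerayVorticity u s)) :=
    continuous_laplacian (contDiff_lerayVorticity_slice hu s (n := 2))
  have hc1 : Continuous fun y => ⟪convect (lerayVorticity u s) (lerayOrbit u s) y, lerayVorticity u s y⟫ := by
    have e : (fun y => convect (lerayVorticity u s) (lerayOrbit u s) y) =
        fun y => fderiv ℝ (lerayOrbit u s) y (lerayVorticity u s y) := by funext y; rfl
    have h : Continuous fun y => convect (lerayVorticity u s) (lerayOrbit u s) y := by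
      rw [e]; exact hcDU.clm_apply hcW
    exact h.inner hcW
  have hc2 : Continuous fun y => ⟪(Δ (lerayVorticity u s)) y, lerayVorticity u s y⟫ := hcΔ.inner hcW
  have hc3 : Continuous fun y => ⟪lerayVorticity u s y, lerayVorticity u s y⟫ := hcW.inner hcW
  have hc4 : Continuous fun y => ⟪fderiv ℝ (lerayVorticity u s) y y, lerayVorticity u s y⟫ :=
    (hcDW.clm_apply continuous_id).inner hcW
  have hc5 : Continuous fun y => ⟪convect (lerayOrbit u s) (lerayVorticity u s) y, lerayVorticity u s y⟫ := by
    have e : (fun y => convect (lerayOrbit u s) (lerayVorticity u s) y) =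
        fun y => fderiv ℝ (lerayVorticity u s) y (lerayOrbit u s y) := by funext y; rfl
    have h : Continuous fun y => convect (lerayOrbit u s) (lerayVorticity u s) y := by
      rw [e]; exact hcDW.clm_apply hcU
    exact h.inner hcW
  -- integrability (the cutoff has compact support)
  have i1 : Integrable fun y => φ y * ⟪convect (lerayVorticity u s) (lerayOrbit u s) y, lerayVorticity u s y⟫ :=
    (hφcont.mul hc1).integrable_of_hasCompactSupport hφc.mul_right
  have i2 : Integrable fun y => φ y * ⟪(Δ (lerayVorticity u s)) y, lerayVorticity u s y⟫ :=
    (hφcont.mul hc2).integrable_of_hasCompactSupport hφc.mul_right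
  have i3 : Integrable fun y => φ y * ⟪lerayVorticity u s y, lerayVorticity u s y⟫ :=
    (hφcont.mul hc3).integrable_of_hasCompactSupport hφc.mul_right
  have i4 : Integrable fun y => φ y * ⟪fderiv ℝ (lerayVorticity u s) y y, lerayVorticity u s y⟫ :=
    (hφcont.mul hc4).integrable_of_hasCompactSupport hφc.mul_right
  have i5 : Integrable fun y => φ y * ⟪convect (lerayOrbit u s) (lerayVorticity u s) y, lerayVorticity u s y⟫ :=
    (hφcont.mul hc5).integrable_of_hasCompactSupport hφc.mul_right
  -- pointwise expansion of the integrand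
  have hpt : ∀ y, φ y * (2 * ⟪timeDerivWithin univ (lerayVorticity u) s y, lerayVorticity u s y⟫) =
      2 * (φ y * ⟪convect (lerayVorticity u s) (lerayOrbit u s) y, lerayVorticity u s y⟫)
        + 2 * (φ y * ⟪(Δ (lerayVorticity u s)) y, lerayVorticity u s y⟫)
        - 2 * (φ y * ⟪lerayVorticity u s y, lerayVorticity u s y⟫)
        - φ y * ⟪fderiv ℝ (lerayVorticity u s) y y, lerayVorticity u s y⟫
        - 2 * (φ y * ⟪convect (lerayOrbit u s) (lerayVorticity u s) y, lerayVorticity u s y⟫) := by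
    intro y
    rw [hpde y]
    exact inner_expand (φ y) _ _ _ _ _
  have hint : (∫ y, φ y * (2 * ⟪timeDerivWithin univ (lerayVorticity u) s y, lerayVorticity u s y⟫)) =
      2 * (∫ y, φ y * ⟪convect (lerayVorticity u s) (lerayOrbit u s) y, lerayVorticity u s y⟫)
        + 2 * (∫ y, φ y * ⟪(Δ (lerayVorticity u s)) y, lerayVorticity u s y⟫)
        - 2 * (∫ y, φ y * ⟪lerayVorticity u s y, lerayVorticity u s y⟫)
        - (∫ y, φ y * ⟪fderiv ℝ (lerayVorticity u s) y y, lerayVorticity u s y⟫)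
        - 2 * (∫ y, φ y * ⟪convect (lerayOrbit u s) (lerayVorticity u s) y, lerayVorticity u s y⟫) := by
    rw [integral_congr_ae (Eventually.of_forall hpt)]
    rw [integral_sub, integral_sub, integral_sub, integral_add, integral_const_mul, integral_const_mul,
      integral_const_mul, integral_const_mul]
    · exact i1.const_mul 2
    · exact i2.const_mul 2
    · exact (i1.const_mul 2).add (i2.const_mul 2)
    · exact i3.const_mul 2
    · exact ((i1.const_mul 2).add (i2.const_mul 2)).sub (i3.const_mul 2)
    · exact i4
    · exact (((i1.const_mul 2).add (i2.const_mul 2)).sub (i3.const_mul 2)).sub i4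
    · exact i5.const_mul 2
  -- identify the production term and `‖Ω‖² = ⟪Ω, Ω⟫`
  have e1 : (∫ y, φ y * ⟪convect (lerayVorticity u s) (lerayOrbit u s) y, lerayVorticity u s y⟫) =
      ∫ y, φ y * ⟪fderiv ℝ (lerayOrbit u s) y (lerayVorticity u s y), lerayVorticity u s y⟫ := by
    rfl
  have e3 : (∫ y, φ y * ⟪lerayVorticity u s y, lerayVorticity u s y⟫) = ∫ y, φ y * ‖lerayVorticity u s y‖ ^ 2 := by
    refine integral_congr_ae (Eventually.of_forall fun y => ?_)
    show φ y * ⟪lerayVorticity u s y, lerayVorticity u s y⟫ = φ y * ‖lerayVorticity u s y‖ ^ 2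
    rw [real_inner_self_eq_norm_sq]
  rw [hint, e1, e3]
  linarith [ibp1, ibp2, ibp3]

/-- **`deriv Z_R`**, assembled: differentiable, with
`Z_R' = −½Z + ½D + T + 2P + V − 2∫φ‖∇Ω‖²_F`. -/
theorem deriv_cutoffEnstrophy_eq {R : ℝ} (hR : 0 < R) (s : ℝ) :
    deriv (fun σ => ∫ y, smoothTransition (2 - ‖y‖ ^ 2 / R ^ 2) * ‖lerayVorticity u σ y‖ ^ 2) s =
      -(1 / 2) * (∫ y, smoothTransition (2 - ‖y‖ ^ 2 / R ^ 2) * ‖lerayVorticity u s y‖ ^ 2)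
        + (1 / 2) * (∫ y, fderiv ℝ (fun z : ℝ³ => smoothTransition (2 - ‖z‖ ^ 2 / R ^ 2)) y y *
            ‖lerayVorticity u s y‖ ^ 2)
        + (∫ y, fderiv ℝ (fun z : ℝ³ => smoothTransition (2 - ‖z‖ ^ 2 / R ^ 2)) y (lerayOrbit u s y) *
            ‖lerayVorticity u s y‖ ^ 2)
        + 2 * (∫ y, smoothTransition (2 - ‖y‖ ^ 2 / R ^ 2) *
            ⟪fderiv ℝ (lerayOrbit u s) y (lerayVorticity u s y), lerayVorticity u s y⟫)
        + (∫ y, ‖lerayVorticity u s y‖ ^ 2 *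
            (Δ (fun z : ℝ³ => smoothTransition (2 - ‖z‖ ^ 2 / R ^ 2))) y)
        - 2 * (∫ y, smoothTransition (2 - ‖y‖ ^ 2 / R ^ 2) *
            frobeniusNormSq (fderiv ℝ (lerayVorticity u s) y)) := by
  rw [(hasDerivAt_cutoffEnstrophy hu hR s).deriv]
  exact enstrophy_identity hu (contDiff_smoothTransition_cutoff (n := ⊤) R)
    (hasCompactSupport_smoothTransition_cutoff hR) s

end Dynamic

/-! ## The lever, verbatim -/

/-- **stub_signedBudget** — verbatim signature of the lead's skeleton v1, proved. -/
theorem stub_signedBudget : ∀ (C a κ' : ℝ) (u : ℝ → ℝ³ → ℝ³), IsTypeIAncientMild C u →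
    (∀ t < 0, ∀ x, lerayMiddleStrain u t x ≤ a) → 0 ≤ a →
    (∀ (s : ℝ) (y : ℝ³), ‖lerayOrbit u s y‖ ≤ C) →
    (∀ ρ : ℝ, 0 < ρ →
      Continuous fun s => ∫ y in Metric.ball (0 : ℝ³) ρ, frobeniusNormSq (fderiv ℝ (lerayOrbit u s) y)) →
    (∀ (R s : ℝ), 1 ≤ R →
      (∫ y, Real.smoothTransition (2 - ‖y‖ ^ 2 / R ^ 2) * frobeniusNormSq (fderiv ℝ (lerayOrbit u s) y)) ≤
        (∫ y, Real.smoothTransition (2 - ‖y‖ ^ 2 / R ^ 2) * ‖lerayVorticity u s y‖ ^ 2) +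
          κ' * Real.sqrt ((∫ y in Metric.ball (0 : ℝ³) (2 * R),
            frobeniusNormSq (fderiv ℝ (lerayOrbit u s) y)) / R)) →
    ∃ κ : ℝ, ∀ R : ℝ, 1 ≤ R →
      Differentiable ℝ (fun s => ∫ y, Real.smoothTransition (2 - ‖y‖ ^ 2 / R ^ 2) * ‖lerayVorticity u s y‖ ^ 2) ∧
      ∃ K : ℝ → ℝ, Continuous K ∧ (∀ s, 0 ≤ K s) ∧
        (∀ s, K s ≤ κ * ((∫ y in Metric.ball (0 : ℝ³) (2 * R), frobeniusNormSq (fderiv ℝ (lerayOrbit u s) y)) / R +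
          Real.sqrt ((∫ y in Metric.ball (0 : ℝ³) (2 * R), frobeniusNormSq (fderiv ℝ (lerayOrbit u s) y)) / R))) ∧
        ∀ s, deriv (fun s => ∫ y, Real.smoothTransition (2 - ‖y‖ ^ 2 / R ^ 2) * ‖lerayVorticity u s y‖ ^ 2) s ≤
          -(2 * (1 / 4 - a)) * (∫ y, Real.smoothTransition (2 - ‖y‖ ^ 2 / R ^ 2) * ‖lerayVorticity u s y‖ ^ 2) + K s := by
  intro C a κ' u hu hΛ ha hUC hEcont hcmp
  obtain ⟨κ, hκ⟩ := lever_static_bound C a κ' u hu hΛ ha hUC hEcont hcmp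
  refine ⟨κ, fun R hR1 => ?_⟩
  have hR : 0 < R := lt_of_lt_of_le one_pos hR1
  obtain ⟨K, hKc, hK0, hKle, hmain⟩ := hκ R hR1
  refine ⟨fun s => (hasDerivAt_cutoffEnstrophy hu hR s).differentiableAt, K, hKc, hK0, hKle, fun s => ?_⟩
  rw [deriv_cutoffEnstrophy_eq hu hR s]
  have hdiss : 0 ≤ ∫ y, smoothTransition (2 - ‖y‖ ^ 2 / R ^ 2) *
      frobeniusNormSq (fderiv ℝ (lerayVorticity u s) y) :=
    integral_nonneg fun y => mul_nonneg (smoothTransition_cutoff_nonneg R y) (frobeniusNormSq_nonneg _)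
  linarith [hmain s]

/-! ## `stub_divCurlBalls` — the div–curl comparison on balls -/

section DivCurl

variable (hu : IsTypeIAncientMild C u)
include hu

/-- The cut-off Frobenius density is integrable (compact support). (gen-1) -/
theorem integrable_cutoff_mul_frobeniusNormSq (s : ℝ) {R : ℝ} (hR : 0 < R) :
    Integrable fun y : ℝ³ => smoothTransition (2 - ‖y‖ ^ 2 / R ^ 2) *
      frobeniusNormSq (fderiv ℝ (lerayOrbit u s) y) :=
  (((contDiff_smoothTransition_cutoff (n := 0) R).continuous).mul
    (continuous_frobeniusNormSq_fderiv_lerayOrbit hu s)).integrable_of_hasCompactSupport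
    ((hasCompactSupport_smoothTransition_cutoff hR).mul_right)

/-- The cut-off enstrophy density is integrable (compact support). (gen-1) -/
theorem integrable_cutoff_mul_vorticity (s : ℝ) {R : ℝ} (hR : 0 < R) :
    Integrable fun y : ℝ³ => smoothTransition (2 - ‖y‖ ^ 2 / R ^ 2) * ‖lerayVorticity u s y‖ ^ 2 :=
  (((contDiff_smoothTransition_cutoff (n := 0) R).continuous).mul
    ((continuous_lerayVorticity hu s).norm.pow 2)).integrable_of_hasCompactSupport
    ((hasCompactSupport_smoothTransition_cutoff hR).mul_right)

/-- **(i)** `Z_R ≤ 6 E(2R)` (in fact `≤ 2 E(2R)`; gen-1). -/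
theorem cutoffEnstrophy_le_six_ballGradEnergy (s : ℝ) {R : ℝ} (hR : 0 < R) :
    (∫ y, smoothTransition (2 - ‖y‖ ^ 2 / R ^ 2) * ‖lerayVorticity u s y‖ ^ 2) ≤
      6 * ∫ y in ball (0 : ℝ³) (2 * R), frobeniusNormSq (fderiv ℝ (lerayOrbit u s) y) := by
  have hf0 : ∀ y, 0 ≤ frobeniusNormSq (fderiv ℝ (lerayOrbit u s) y) := fun y => frobeniusNormSq_nonneg _
  have hφ0 : ∀ y : ℝ³, 0 ≤ smoothTransition (2 - ‖y‖ ^ 2 / R ^ 2) := fun y =>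
    smoothTransition_cutoff_nonneg R y
  have hφ1 : ∀ y : ℝ³, smoothTransition (2 - ‖y‖ ^ 2 / R ^ 2) ≤ 1 := fun y =>
    smoothTransition_cutoff_le_one R y
  have hI2 : Integrable fun y : ℝ³ => smoothTransition (2 - ‖y‖ ^ 2 / R ^ 2) *
      (2 * frobeniusNormSq (fderiv ℝ (lerayOrbit u s) y)) := by
    refine ((integrable_cutoff_mul_frobeniusNormSq hu s hR).const_mul 2).congr ?_
    filter_upwards with y
    ring
  have h1 : (∫ y, smoothTransition (2 - ‖y‖ ^ 2 / R ^ 2) * ‖lerayVorticity u s y‖ ^ 2) ≤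
      ∫ y, smoothTransition (2 - ‖y‖ ^ 2 / R ^ 2) * (2 * frobeniusNormSq (fderiv ℝ (lerayOrbit u s) y)) := by
    refine integral_mono (integrable_cutoff_mul_vorticity hu s hR) hI2 fun y => ?_
    refine mul_le_mul_of_nonneg_left ?_ (hφ0 y)
    rw [lerayVorticity_apply]
    exact norm_curl_sq_le_two_mul_frobeniusNormSq _ _
  have h2 : (∫ y, smoothTransition (2 - ‖y‖ ^ 2 / R ^ 2) * (2 * frobeniusNormSq (fderiv ℝ (lerayOrbit u s) y))) =
      ∫ y in closedBall (0 : ℝ³) (2 * R),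
        smoothTransition (2 - ‖y‖ ^ 2 / R ^ 2) * (2 * frobeniusNormSq (fderiv ℝ (lerayOrbit u s) y)) := by
    refine (setIntegral_eq_integral_of_forall_compl_eq_zero fun y hy => ?_).symm
    rw [smoothTransition_cutoff_eq_zero_of_notMem hR hy, zero_mul]
  have hfi : IntegrableOn (fun y => 2 * frobeniusNormSq (fderiv ℝ (lerayOrbit u s) y)) (closedBall (0 : ℝ³) (2 * R)) :=
    ((continuous_const.mul (continuous_frobeniusNormSq_fderiv_lerayOrbit hu s)).continuousOn).integrableOn_compact
      (isCompact_closedBall _ _)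
  have h3 : (∫ y in closedBall (0 : ℝ³) (2 * R),
        smoothTransition (2 - ‖y‖ ^ 2 / R ^ 2) * (2 * frobeniusNormSq (fderiv ℝ (lerayOrbit u s) y))) ≤
      ∫ y in closedBall (0 : ℝ³) (2 * R), 2 * frobeniusNormSq (fderiv ℝ (lerayOrbit u s) y) := by
    refine setIntegral_mono_on hI2.integrableOn hfi measurableSet_closedBall fun y _ => ?_
    have h2f : 0 ≤ 2 * frobeniusNormSq (fderiv ℝ (lerayOrbit u s) y) := mul_nonneg zero_le_two (hf0 y)
    have := mul_le_mul_of_nonneg_right (hφ1 y) h2f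
    linarith
  have h4 : (∫ y in closedBall (0 : ℝ³) (2 * R), 2 * frobeniusNormSq (fderiv ℝ (lerayOrbit u s) y)) =
      2 * ∫ y in ball (0 : ℝ³) (2 * R), frobeniusNormSq (fderiv ℝ (lerayOrbit u s) y) := by
    rw [integral_const_mul, setIntegral_congr_set (ball_ae_eq_closedBall' (2 * R))]
  have h5 : 0 ≤ ∫ y in ball (0 : ℝ³) (2 * R), frobeniusNormSq (fderiv ℝ (lerayOrbit u s) y) :=
    ballGradEnergy_nonneg u (2 * R) s
  linarith

/-- **(iii)** `E(R) ≤ ∫ φ_R |∇U|²_F` (`φ_R = 1` on `B_R`, integrand `≥ 0`; gen-1). -/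
theorem ballGradEnergy_le_cutoff (s : ℝ) {R : ℝ} (hR : 0 < R) :
    (∫ y in ball (0 : ℝ³) R, frobeniusNormSq (fderiv ℝ (lerayOrbit u s) y)) ≤
      ∫ y, smoothTransition (2 - ‖y‖ ^ 2 / R ^ 2) * frobeniusNormSq (fderiv ℝ (lerayOrbit u s) y) := by
  have hint := integrable_cutoff_mul_frobeniusNormSq hu s hR
  calc (∫ y in ball (0 : ℝ³) R, frobeniusNormSq (fderiv ℝ (lerayOrbit u s) y))
      = ∫ y in ball (0 : ℝ³) R, smoothTransition (2 - ‖y‖ ^ 2 / R ^ 2) *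
          frobeniusNormSq (fderiv ℝ (lerayOrbit u s) y) := by
        refine setIntegral_congr_fun measurableSet_ball fun y hy => ?_
        rw [mem_ball, dist_zero_right] at hy
        rw [smoothTransition_cutoff_eq_one hR hy.le, one_mul]
    _ ≤ ∫ y, smoothTransition (2 - ‖y‖ ^ 2 / R ^ 2) * frobeniusNormSq (fderiv ℝ (lerayOrbit u s) y) :=
        setIntegral_le_integral hint (Eventually.of_forall fun y =>
          mul_nonneg (smoothTransition_cutoff_nonneg R y) (frobeniusNormSq_nonneg _))

/-- **(iv)** `Z_R ≤ Z_{R'}` for `0 < R ≤ R'` (the cutoffs are ordered; gen-1). -/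
theorem cutoffEnstrophy_mono (s : ℝ) {R R' : ℝ} (hR : 0 < R) (hRR' : R ≤ R') :
    (∫ y, smoothTransition (2 - ‖y‖ ^ 2 / R ^ 2) * ‖lerayVorticity u s y‖ ^ 2) ≤
      ∫ y, smoothTransition (2 - ‖y‖ ^ 2 / R' ^ 2) * ‖lerayVorticity u s y‖ ^ 2 := by
  have hR' : 0 < R' := lt_of_lt_of_le hR hRR'
  refine integral_mono (integrable_cutoff_mul_vorticity hu s hR) (integrable_cutoff_mul_vorticity hu s hR')
    fun y => ?_
  refine mul_le_mul_of_nonneg_right (Real.smoothTransition.monotone ?_) (sq_nonneg _)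
  have h : ‖y‖ ^ 2 / R' ^ 2 ≤ ‖y‖ ^ 2 / R ^ 2 :=
    div_le_div_of_nonneg_left (sq_nonneg _) (by positivity) (pow_le_pow_left₀ hR.le hRR' 2)
  linarith

/-- **The div–curl identity against a cutoff**: for any `φ ∈ C^∞_c`,
`∫ φ ‖DU‖²_F = ∫ φ ‖Ω‖² − ∫ ⟪(U·∇)U, ∇φ⟫` (`‖DU‖²_F = ‖curl U‖² + tr(DU∘DU)`,
`tr(DU∘DU) = div((U·∇)U)` for `div U = 0`, Gauss–Green). -/
theorem integral_cutoff_frob_eq {φ : ℝ³ → ℝ} (hφ : ContDiff ℝ ∞ φ) (hφc : HasCompactSupport φ) (s : ℝ) :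
    (∫ y, φ y * frobeniusNormSq (fderiv ℝ (lerayOrbit u s) y)) =
      (∫ y, φ y * ‖lerayVorticity u s y‖ ^ 2) -
        ∫ y, ⟪convect (lerayOrbit u s) (lerayOrbit u s) y, gradient φ y⟫ := by
  have hU : ContDiff ℝ ∞ (lerayOrbit u s) := contDiff_lerayOrbit_slice hu s (n := ⊤)
  have hU2 : ContDiff ℝ 2 (lerayOrbit u s) := contDiff_lerayOrbit_slice hu s (n := 2)
  have hU1 : ContDiff ℝ 1 (lerayOrbit u s) := contDiff_lerayOrbit_slice hu s (n := 1)
  have hdiv : VectorCalculus.IsDivFree (lerayOrbit u s) :=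
    (isDivFree_lerayOrbit_iff u s).2 (hu.isDivFree (neg_neg_of_pos (Real.exp_pos _)))
  have hφcont : Continuous φ := hφ.continuous
  have hφ1 : ContDiff ℝ 1 φ := hφ.of_le (by exact_mod_cast le_top)
  -- `convect U U` is `C¹`
  have hconv : ContDiff ℝ 1 (convect (lerayOrbit u s) (lerayOrbit u s)) := by
    have e : convect (lerayOrbit u s) (lerayOrbit u s) = fun y => fderiv ℝ (lerayOrbit u s) y (lerayOrbit u s y) := by
      funext y; rfl
    rw [e]
    exact (hU2.fderiv_right (m := 1) le_rfl).clm_apply hU1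
  -- pointwise: `frob = ‖curl‖² + tr`, `tr = div (convect U U)`
  have hpt : ∀ y, φ y * frobeniusNormSq (fderiv ℝ (lerayOrbit u s) y) =
      φ y * ‖lerayVorticity u s y‖ ^ 2 +
        φ y * VectorCalculus.divergence (convect (lerayOrbit u s) (lerayOrbit u s)) y := by
    intro y
    have h1 := Summit.NavierStokesRegularity.NavierStokesRegularity.Theorems.norm_curl_sq_eq_frobeniusNormSq_sub_trace
      (lerayOrbit u s) y
    have h2 : VectorCalculus.divergence (convect (lerayOrbit u s) (lerayOrbit u s)) y =
        LinearMap.trace ℝ ℝ³ ((fderiv ℝ (lerayOrbit u s) y : ℝ³ →ₗ[ℝ] ℝ³) ∘ₗ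
          (fderiv ℝ (lerayOrbit u s) y : ℝ³ →ₗ[ℝ] ℝ³)) := by
      rw [divergence_convect_self_eq hU2 hdiv y, traceCLM_apply]
      rfl
    rw [lerayVorticity_apply, h1, h2]
    ring
  -- Gauss–Green
  have hgg := integral_mul_divergence_add_eq_zero_left hφ1 hconv hφc
  -- integrability
  have iZ : Integrable fun y => φ y * ‖lerayVorticity u s y‖ ^ 2 :=
    (hφcont.mul ((continuous_lerayVorticity hu s).norm.pow 2)).integrable_of_hasCompactSupport hφc.mul_right
  have iD : Integrable fun y => φ y * VectorCalculus.divergence (convect (lerayOrbit u s) (lerayOrbit u s)) y :=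
    (hφcont.mul (continuous_divergence (hconv.continuous_fderiv one_ne_zero))).integrable_of_hasCompactSupport
      hφc.mul_right
  rw [integral_congr_ae (Eventually.of_forall hpt), integral_add iZ iD]
  linarith

omit hu in
/-- `√(A R) √E / R = √A √(E/R)` bookkeeping. -/
theorem sqrt_bookkeeping (c A E R : ℝ) (hA : 0 ≤ A) (hE : 0 ≤ E) (hR : 0 < R) :
    c / R * (Real.sqrt (A * R) * Real.sqrt E) = c * Real.sqrt A * Real.sqrt (E / R) := by
  set r : ℝ := Real.sqrt R with hr
  have hr0 : 0 < r := Real.sqrt_pos.2 hR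
  have hR' : R = r ^ 2 := (Real.sq_sqrt hR.le).symm
  rw [hR', Real.sqrt_mul hA, Real.sqrt_sq hr0.le, Real.sqrt_div hE, Real.sqrt_sq hr0.le]
  field_simp

/-- **The collar flux of the div–curl identity**: with the Morrey bound
`∫_{B_ρ(y₀)}‖U‖² ≤ Cρ`, `|∫ ⟪(U·∇)U, ∇φ_R⟫| ≤ c₁ √(2C) √(E(2R)/R)`
(`‖DU‖ ≤ √‖DU‖²_F`, `‖∇φ_R‖ ≤ c₁/R` on `closedBall 2R`, Cauchy–Schwarz on the closed ball). -/
theorem collar_flux_le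
    (hM : ∀ (s : ℝ) (y₀ : ℝ³) (ρ : ℝ), 0 < ρ → ∫ y in ball y₀ ρ, ‖lerayOrbit u s y‖ ^ 2 ≤ C * ρ)
    {c₁ : ℝ} (hc₁0 : 0 ≤ c₁)
    (hc₁ : ∀ R : ℝ, 0 < R → ∀ y : ℝ³,
      ‖fderiv ℝ (fun z : ℝ³ => smoothTransition (2 - ‖z‖ ^ 2 / R ^ 2)) y‖ ≤ c₁ / R)
    {R : ℝ} (hR : 0 < R) (s : ℝ) :
    |∫ y, ⟪convect (lerayOrbit u s) (lerayOrbit u s) y,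
        gradient (fun z : ℝ³ => smoothTransition (2 - ‖z‖ ^ 2 / R ^ 2)) y⟫| ≤
      c₁ * Real.sqrt (2 * C) *
        Real.sqrt ((∫ y in ball (0 : ℝ³) (2 * R), frobeniusNormSq (fderiv ℝ (lerayOrbit u s) y)) / R) := by
  have hC : 0 ≤ C := hu.nonneg
  have hφ1 : ContDiff ℝ 1 fun z : ℝ³ => smoothTransition (2 - ‖z‖ ^ 2 / R ^ 2) :=
    contDiff_smoothTransition_cutoff (n := 1) R
  have hcU : Continuous (lerayOrbit u s) := (contDiff_lerayOrbit_slice hu s (n := 0)).continuous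
  have hcF : Continuous fun y => frobeniusNormSq (fderiv ℝ (lerayOrbit u s) y) :=
    continuous_frobeniusNormSq_fderiv_lerayOrbit hu s
  have hcsq : Continuous fun y => Real.sqrt (frobeniusNormSq (fderiv ℝ (lerayOrbit u s) y)) := hcF.sqrt
  have hcDφ : Continuous fun y => ‖fderiv ℝ (fun z : ℝ³ => smoothTransition (2 - ‖z‖ ^ 2 / R ^ 2)) y‖ :=
    (hφ1.continuous_fderiv one_ne_zero).norm
  set E2 : ℝ := ∫ y in ball (0 : ℝ³) (2 * R), frobeniusNormSq (fderiv ℝ (lerayOrbit u s) y) with hE2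
  have hE0 : 0 ≤ E2 := ballGradEnergy_nonneg u (2 * R) s
  -- majorant `G = ‖Dφ‖ · ‖U‖ · √frob`
  set G : ℝ³ → ℝ := fun y => ‖fderiv ℝ (fun z : ℝ³ => smoothTransition (2 - ‖z‖ ^ 2 / R ^ 2)) y‖ *
    (‖lerayOrbit u s y‖ * Real.sqrt (frobeniusNormSq (fderiv ℝ (lerayOrbit u s) y))) with hG
  have hGc : Continuous G := hcDφ.mul (hcU.norm.mul hcsq)
  have hG0 : ∀ y ∉ closedBall (0 : ℝ³) (2 * R), G y = 0 := fun y hy => by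
    show ‖fderiv ℝ (fun z : ℝ³ => smoothTransition (2 - ‖z‖ ^ 2 / R ^ 2)) y‖ * _ = 0
    rw [fderiv_cutoff_eq_zero hR hy, norm_zero, zero_mul]
  have hGi : Integrable G := integrable_of_continuous_of_eq_zero hGc hG0
  -- pointwise domination
  have hdom : ∀ y, ‖⟪convect (lerayOrbit u s) (lerayOrbit u s) y,
      gradient (fun z : ℝ³ => smoothTransition (2 - ‖z‖ ^ 2 / R ^ 2)) y⟫‖ ≤ G y := by
    intro y
    have hop : ‖fderiv ℝ (lerayOrbit u s) y‖ ≤ Real.sqrt (frobeniusNormSq (fderiv ℝ (lerayOrbit u s) y)) :=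
      Real.le_sqrt_of_sq_le (sq_opNorm_le_frobeniusNormSq _)
    calc ‖⟪convect (lerayOrbit u s) (lerayOrbit u s) y,
          gradient (fun z : ℝ³ => smoothTransition (2 - ‖z‖ ^ 2 / R ^ 2)) y⟫‖
        ≤ ‖convect (lerayOrbit u s) (lerayOrbit u s) y‖ *
            ‖gradient (fun z : ℝ³ => smoothTransition (2 - ‖z‖ ^ 2 / R ^ 2)) y‖ := norm_inner_le_norm _ _
      _ ≤ (‖fderiv ℝ (lerayOrbit u s) y‖ * ‖lerayOrbit u s y‖) *
            ‖fderiv ℝ (fun z : ℝ³ => smoothTransition (2 - ‖z‖ ^ 2 / R ^ 2)) y‖ := by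
          rw [norm_gradient_eq]
          exact mul_le_mul_of_nonneg_right (ContinuousLinearMap.le_opNorm _ _) (norm_nonneg _)
      _ ≤ (Real.sqrt (frobeniusNormSq (fderiv ℝ (lerayOrbit u s) y)) * ‖lerayOrbit u s y‖) *
            ‖fderiv ℝ (fun z : ℝ³ => smoothTransition (2 - ‖z‖ ^ 2 / R ^ 2)) y‖ := by
          gcongr
      _ = G y := by rw [hG]; ring
  have h1 : |∫ y, ⟪convect (lerayOrbit u s) (lerayOrbit u s) y,
      gradient (fun z : ℝ³ => smoothTransition (2 - ‖z‖ ^ 2 / R ^ 2)) y⟫| ≤ ∫ y, G y := by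
    have := norm_integral_le_of_norm_le hGi (Eventually.of_forall hdom)
    simpa only [Real.norm_eq_abs] using this
  -- `∫ G ≤ (c₁/R) ∫_{closedBall} ‖U‖ √frob`
  have h2 : (∫ y, G y) = ∫ y in closedBall (0 : ℝ³) (2 * R), G y :=
    (setIntegral_eq_integral_of_forall_compl_eq_zero hG0).symm
  set H : ℝ³ → ℝ := fun y => ‖lerayOrbit u s y‖ * Real.sqrt (frobeniusNormSq (fderiv ℝ (lerayOrbit u s) y)) with hH
  have hHc : Continuous H := hcU.norm.mul hcsq
  have hH0 : ∀ y, 0 ≤ H y := fun y => mul_nonneg (norm_nonneg _) (Real.sqrt_nonneg _)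
  have hHi : IntegrableOn H (closedBall (0 : ℝ³) (2 * R)) :=
    (hHc.continuousOn).integrableOn_compact (isCompact_closedBall _ _)
  have h3 : (∫ y in closedBall (0 : ℝ³) (2 * R), G y) ≤ ∫ y in closedBall (0 : ℝ³) (2 * R), (c₁ / R) * H y := by
    refine setIntegral_mono_on hGi.integrableOn (hHi.const_mul _) measurableSet_closedBall fun y _ => ?_
    show ‖fderiv ℝ (fun z : ℝ³ => smoothTransition (2 - ‖z‖ ^ 2 / R ^ 2)) y‖ * H y ≤ c₁ / R * H y
    exact mul_le_mul_of_nonneg_right (hc₁ R hR y) (hH0 y)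
  rw [integral_const_mul] at h3
  -- Cauchy–Schwarz on the closed ball
  haveI : IsFiniteMeasure ((volume : Measure ℝ³).restrict (closedBall (0 : ℝ³) (2 * R))) :=
    isFiniteMeasure_restrict.2 (measure_closedBall_lt_top).ne
  obtain ⟨MU, hMU⟩ := (isCompact_closedBall (0 : ℝ³) (2 * R)).exists_bound_of_continuousOn hcU.norm.continuousOn
  obtain ⟨MF, hMF⟩ := (isCompact_closedBall (0 : ℝ³) (2 * R)).exists_bound_of_continuousOn hcsq.continuousOn
  have mU : MemLp (fun y => ‖lerayOrbit u s y‖) (ENNReal.ofReal 2)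
      ((volume : Measure ℝ³).restrict (closedBall (0 : ℝ³) (2 * R))) :=
    MemLp.of_bound hcU.norm.aestronglyMeasurable MU
      ((ae_restrict_iff' measurableSet_closedBall).2 (Eventually.of_forall fun y hy => hMU y hy))
  have mF : MemLp (fun y => Real.sqrt (frobeniusNormSq (fderiv ℝ (lerayOrbit u s) y))) (ENNReal.ofReal 2)
      ((volume : Measure ℝ³).restrict (closedBall (0 : ℝ³) (2 * R))) :=
    MemLp.of_bound hcsq.aestronglyMeasurable MF
      ((ae_restrict_iff' measurableSet_closedBall).2 (Eventually.of_forall fun y hy => hMF y hy))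
  have hCS := integral_mul_le_Lp_mul_Lq_of_nonneg (μ := (volume : Measure ℝ³).restrict (closedBall (0 : ℝ³) (2 * R)))
    Real.HolderConjugate.two_two (Eventually.of_forall fun y => norm_nonneg _)
    (Eventually.of_forall fun y => Real.sqrt_nonneg _) mU mF
  -- rewrite the two factors
  have eU : (∫ y in closedBall (0 : ℝ³) (2 * R), ‖lerayOrbit u s y‖ ^ (2 : ℝ)) =
      ∫ y in ball (0 : ℝ³) (2 * R), ‖lerayOrbit u s y‖ ^ 2 := by
    rw [setIntegral_congr_set (ball_ae_eq_closedBall' (2 * R))]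
    refine integral_congr_ae (Eventually.of_forall fun y => ?_)
    exact Real.rpow_two _
  have eF : (∫ y in closedBall (0 : ℝ³) (2 * R),
      Real.sqrt (frobeniusNormSq (fderiv ℝ (lerayOrbit u s) y)) ^ (2 : ℝ)) = E2 := by
    rw [hE2, setIntegral_congr_set (ball_ae_eq_closedBall' (2 * R))]
    refine integral_congr_ae (Eventually.of_forall fun y => ?_)
    show Real.sqrt (frobeniusNormSq (fderiv ℝ (lerayOrbit u s) y)) ^ (2 : ℝ) = _
    rw [Real.rpow_two, Real.sq_sqrt (frobeniusNormSq_nonneg _)]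
  rw [eU, eF] at hCS
  have hball := hM s 0 (2 * R) (by positivity)
  have hint0 : 0 ≤ ∫ y in ball (0 : ℝ³) (2 * R), ‖lerayOrbit u s y‖ ^ 2 :=
    setIntegral_nonneg measurableSet_ball fun _ _ => sq_nonneg _
  have h4 : (∫ y in ball (0 : ℝ³) (2 * R), ‖lerayOrbit u s y‖ ^ 2) ^ (1 / (2 : ℝ)) ≤ Real.sqrt (2 * C * R) := by
    rw [← Real.sqrt_eq_rpow]
    exact Real.sqrt_le_sqrt (by linarith)
  have h5 : E2 ^ (1 / (2 : ℝ)) = Real.sqrt E2 := (Real.sqrt_eq_rpow E2).symm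
  rw [h5] at hCS
  have hsqE : 0 ≤ Real.sqrt E2 := Real.sqrt_nonneg _
  have h6 : (∫ y in closedBall (0 : ℝ³) (2 * R), H y) ≤ Real.sqrt (2 * C * R) * Real.sqrt E2 := by
    refine hCS.trans ?_
    exact mul_le_mul_of_nonneg_right h4 hsqE
  have hcR : 0 ≤ c₁ / R := div_nonneg hc₁0 hR.le
  have h7 : c₁ / R * (∫ y in closedBall (0 : ℝ³) (2 * R), H y) ≤ c₁ / R * (Real.sqrt (2 * C * R) * Real.sqrt E2) :=
    mul_le_mul_of_nonneg_left h6 hcR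
  rw [sqrt_bookkeeping c₁ (2 * C) E2 R (by positivity) hE0 hR] at h7
  linarith

/-- **(ii)** `∫ φ_R ‖DU‖²_F ≤ Z_R + κ' √(E(2R)/R)` with `κ' = c₁ √(2C)`. -/
theorem cutoff_frob_le_cutoffEnstrophy_add
    (hM : ∀ (s : ℝ) (y₀ : ℝ³) (ρ : ℝ), 0 < ρ → ∫ y in ball y₀ ρ, ‖lerayOrbit u s y‖ ^ 2 ≤ C * ρ)
    {c₁ : ℝ} (hc₁0 : 0 ≤ c₁)
    (hc₁ : ∀ R : ℝ, 0 < R → ∀ y : ℝ³,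
      ‖fderiv ℝ (fun z : ℝ³ => smoothTransition (2 - ‖z‖ ^ 2 / R ^ 2)) y‖ ≤ c₁ / R)
    {R : ℝ} (hR : 0 < R) (s : ℝ) :
    (∫ y, smoothTransition (2 - ‖y‖ ^ 2 / R ^ 2) * frobeniusNormSq (fderiv ℝ (lerayOrbit u s) y)) ≤
      (∫ y, smoothTransition (2 - ‖y‖ ^ 2 / R ^ 2) * ‖lerayVorticity u s y‖ ^ 2) +
        c₁ * Real.sqrt (2 * C) *
          Real.sqrt ((∫ y in ball (0 : ℝ³) (2 * R), frobeniusNormSq (fderiv ℝ (lerayOrbit u s) y)) / R) := by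
  have hid := integral_cutoff_frob_eq hu (φ := fun z : ℝ³ => smoothTransition (2 - ‖z‖ ^ 2 / R ^ 2))
    (contDiff_smoothTransition_cutoff (n := ⊤) R) (hasCompactSupport_smoothTransition_cutoff hR) s
  have hfl := (abs_le.1 (collar_flux_le hu hM hc₁0 hc₁ hR s)).1
  beta_reduce at hid
  linarith

/-- **stub_divCurlBalls**, verbatim signature of the lead's skeleton v1, proved. -/
theorem stub_divCurlBalls' :
    (∀ (s : ℝ) (y₀ : ℝ³) (ρ : ℝ), 0 < ρ →
      ∫ y in Metric.ball y₀ ρ, ‖lerayOrbit u s y‖ ^ 2 ≤ C * ρ) →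
    ∃ κ' : ℝ, ∀ (R s : ℝ), 1 ≤ R →
      (∫ y, Real.smoothTransition (2 - ‖y‖ ^ 2 / R ^ 2) * ‖lerayVorticity u s y‖ ^ 2) ≤
          6 * ∫ y in Metric.ball (0 : ℝ³) (2 * R), frobeniusNormSq (fderiv ℝ (lerayOrbit u s) y) ∧
      (∫ y, Real.smoothTransition (2 - ‖y‖ ^ 2 / R ^ 2) * frobeniusNormSq (fderiv ℝ (lerayOrbit u s) y)) ≤
          (∫ y, Real.smoothTransition (2 - ‖y‖ ^ 2 / R ^ 2) * ‖lerayVorticity u s y‖ ^ 2) +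
            κ' * Real.sqrt ((∫ y in Metric.ball (0 : ℝ³) (2 * R),
              frobeniusNormSq (fderiv ℝ (lerayOrbit u s) y)) / R) ∧
      (∫ y in Metric.ball (0 : ℝ³) R, frobeniusNormSq (fderiv ℝ (lerayOrbit u s) y)) ≤
          (∫ y, Real.smoothTransition (2 - ‖y‖ ^ 2 / R ^ 2) * frobeniusNormSq (fderiv ℝ (lerayOrbit u s) y)) ∧
      (∀ R' : ℝ, R ≤ R' →
        (∫ y, Real.smoothTransition (2 - ‖y‖ ^ 2 / R ^ 2) * ‖lerayVorticity u s y‖ ^ 2) ≤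
          (∫ y, Real.smoothTransition (2 - ‖y‖ ^ 2 / R' ^ 2) * ‖lerayVorticity u s y‖ ^ 2)) := by
  intro hM
  obtain ⟨c₁, hc₁0, hc₁⟩ := exists_norm_fderiv_smoothTransition_cutoff_le (E := ℝ³)
  refine ⟨c₁ * Real.sqrt (2 * C), fun R s hR1 => ?_⟩
  have hR : 0 < R := lt_of_lt_of_le one_pos hR1
  exact ⟨cutoffEnstrophy_le_six_ballGradEnergy hu s hR,
    cutoff_frob_le_cutoffEnstrophy_add hu hM hc₁0 hc₁ hR s,
    ballGradEnergy_le_cutoff hu s hR,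
    fun R' hRR' => cutoffEnstrophy_mono hu s hR hRR'⟩

end DivCurl

/-- **stub_divCurlBalls**, verbatim signature of the lead's skeleton v1, proved. -/
theorem stub_divCurlBalls : ∀ (C : ℝ) (u : ℝ → ℝ³ → ℝ³), IsTypeIAncientMild C u →
    (∀ (s : ℝ) (y₀ : ℝ³) (ρ : ℝ), 0 < ρ →
      ∫ y in Metric.ball y₀ ρ, ‖lerayOrbit u s y‖ ^ 2 ≤ C * ρ) →
    ∃ κ' : ℝ, ∀ (R s : ℝ), 1 ≤ R →
      (∫ y, Real.smoothTransition (2 - ‖y‖ ^ 2 / R ^ 2) * ‖lerayVorticity u s y‖ ^ 2) ≤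
          6 * ∫ y in Metric.ball (0 : ℝ³) (2 * R), frobeniusNormSq (fderiv ℝ (lerayOrbit u s) y) ∧
      (∫ y, Real.smoothTransition (2 - ‖y‖ ^ 2 / R ^ 2) * frobeniusNormSq (fderiv ℝ (lerayOrbit u s) y)) ≤
          (∫ y, Real.smoothTransition (2 - ‖y‖ ^ 2 / R ^ 2) * ‖lerayVorticity u s y‖ ^ 2) +
            κ' * Real.sqrt ((∫ y in Metric.ball (0 : ℝ³) (2 * R),
              frobeniusNormSq (fderiv ℝ (lerayOrbit u s) y)) / R) ∧
      (∫ y in Metric.ball (0 : ℝ³) R, frobeniusNormSq (fderiv ℝ (lerayOrbit u s) y)) ≤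
          (∫ y, Real.smoothTransition (2 - ‖y‖ ^ 2 / R ^ 2) * frobeniusNormSq (fderiv ℝ (lerayOrbit u s) y)) ∧
      (∀ R' : ℝ, R ≤ R' →
        (∫ y, Real.smoothTransition (2 - ‖y‖ ^ 2 / R ^ 2) * ‖lerayVorticity u s y‖ ^ 2) ≤
          (∫ y, Real.smoothTransition (2 - ‖y‖ ^ 2 / R' ^ 2) * ‖lerayVorticity u s y‖ ^ 2)) :=
  fun _C _u hu hM => stub_divCurlBalls' hu hM

/-! ## `stub_gradEnergyAverage` — H5b in similarity variables -/

section GradEnergy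

variable (hu : IsTypeIAncientMild C u)
include hu

omit hu in
/-- `frobeniusNormSq (a • L) = a² · frobeniusNormSq L`. -/
theorem frobeniusNormSq_smul (a : ℝ) (L : ℝ³ →L[ℝ] ℝ³) :
    frobeniusNormSq (a • L) = a ^ 2 * frobeniusNormSq L := by
  unfold frobeniusNormSq
  rw [Finset.mul_sum]
  refine Finset.sum_congr rfl fun i _ => ?_
  rw [show (a • L) (stdOrthonormalBasis ℝ ℝ³ i) = a • L (stdOrthonormalBasis ℝ ℝ³ i) from rfl,
    norm_smul, mul_pow, Real.norm_eq_abs, sq_abs]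

omit hu in
/-- `frobeniusNormSq L ≤ 3 ‖L‖²` on `ℝ³` (three unit vectors). -/
theorem frobeniusNormSq_le_three_mul_sq (L : ℝ³ →L[ℝ] ℝ³) : frobeniusNormSq L ≤ 3 * ‖L‖ ^ 2 := by
  unfold frobeniusNormSq
  have h : ∀ i, ‖L (stdOrthonormalBasis ℝ ℝ³ i)‖ ^ 2 ≤ ‖L‖ ^ 2 := fun i => by
    have h1 : ‖L (stdOrthonormalBasis ℝ ℝ³ i)‖ ≤ ‖L‖ := by
      have := L.le_opNorm (stdOrthonormalBasis ℝ ℝ³ i)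
      rwa [(stdOrthonormalBasis ℝ ℝ³).orthonormal.1 i, mul_one] at this
    exact pow_le_pow_left₀ (norm_nonneg _) h1 2
  calc ∑ i, ‖L (stdOrthonormalBasis ℝ ℝ³ i)‖ ^ 2 ≤ ∑ _i : Fin (Module.finrank ℝ ℝ³), ‖L‖ ^ 2 :=
        Finset.sum_le_sum fun i _ => h i
    _ = 3 * ‖L‖ ^ 2 := by
        rw [Finset.sum_const, Finset.card_univ, Fintype.card_fin, finrank_euclideanSpace_fin, nsmul_eq_mul]
        norm_num

/-- **Continuity in time of the physical local gradient energy** `t ↦ ∫_{B_r} ‖Du(t)‖²` on every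
compact interval of negative times (dominated convergence; `Du` is jointly continuous on the
open slab). -/
theorem continuousOn_ballGrad (r : ℝ) {α β : ℝ} (hβ : β < 0) :
    ContinuousOn (fun t => ∫ x in ball (0 : ℝ³) r, ‖fderiv ℝ (u t) x‖ ^ 2) (Icc α β) := by
  have hslab : ContinuousOn (fun p : ℝ × ℝ³ => fderiv ℝ (u p.1) p.2) (Iio 0 ×ˢ univ) :=
    continuousOn_fderiv_slice_of_contDiffOn (hu.1.of_le (by exact_mod_cast le_top)) isOpen_Iio.uniqueDiffOn
  have hP : ContinuousOn (fun p : ℝ × ℝ³ => ‖fderiv ℝ (u p.1) p.2‖ ^ 2) (Iio 0 ×ˢ univ) := (hslab.norm).pow 2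
  have hK : IsCompact (Icc α β ×ˢ closedBall (0 : ℝ³) r) := isCompact_Icc.prod (isCompact_closedBall _ _)
  have hKsub : Icc α β ×ˢ closedBall (0 : ℝ³) r ⊆ Iio 0 ×ˢ univ :=
    prod_mono (fun t ht => lt_of_le_of_lt ht.2 hβ) (subset_univ _)
  obtain ⟨M, hM⟩ := hK.exists_bound_of_continuousOn (hP.mono hKsub)
  haveI : IsFiniteMeasure ((volume : Measure ℝ³).restrict (ball (0 : ℝ³) r)) :=
    isFiniteMeasure_restrict.2 (measure_ball_lt_top).ne
  refine continuousOn_of_dominated (bound := fun _ => M) ?_ ?_ (integrable_const M) ?_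
  · intro t ht
    have htneg : t < 0 := lt_of_le_of_lt ht.2 hβ
    have h1 : ContDiff ℝ 1 (u t) := (hu.contDiff_slice htneg).of_le (by exact_mod_cast le_top)
    exact (((h1.continuous_fderiv one_ne_zero).norm).pow 2).aestronglyMeasurable
  · intro t ht
    refine (ae_restrict_iff' measurableSet_ball).2 (Eventually.of_forall fun x hx => ?_)
    have h := hM (t, x) (mk_mem_prod ht (ball_subset_closedBall hx))
    rw [Real.norm_eq_abs, abs_of_nonneg (sq_nonneg _)] at h
    rw [Real.norm_eq_abs, abs_of_nonneg (sq_nonneg _)]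
    exact h
  · refine Eventually.of_forall fun x => ?_
    have hline : ContinuousOn (fun t : ℝ => ((t, x) : ℝ × ℝ³)) (Icc α β) :=
      (continuous_id.prodMk continuous_const).continuousOn
    have hmaps : MapsTo (fun t : ℝ => ((t, x) : ℝ × ℝ³)) (Icc α β) (Iio 0 ×ˢ univ) :=
      fun t ht => mk_mem_prod (lt_of_le_of_lt ht.2 hβ) (mem_univ x)
    have key : ContinuousOn ((fun p : ℝ × ℝ³ => ‖fderiv ℝ (u p.1) p.2‖ ^ 2) ∘
        fun t : ℝ => ((t, x) : ℝ × ℝ³)) (Icc α β) := hP.comp hline hmaps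
    exact key

omit hu in
/-- The physical local gradient energy is nonnegative. -/
theorem ballGrad_nonneg (v : ℝ → ℝ³ → ℝ³) (t r : ℝ) : 0 ≤ ∫ x in ball (0 : ℝ³) r, ‖fderiv ℝ (v t) x‖ ^ 2 :=
  setIntegral_nonneg measurableSet_ball fun _ _ => sq_nonneg _

/-- **Space scaling**: with `c = e^{-σ/2}`, `t = -e^{-σ}` and `c ρ ≤ r`,
`E(ρ, σ) ≤ 3 c ∫_{B_r} ‖Du(t)‖²` (`DU(σ,y) = e^{-σ} Du(t)(cy)`, `|·|²_F ≤ 3‖·‖²`, `dy = c^{-3} dx`). -/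
theorem ballGradEnergy_le_scaled (σ : ℝ) {ρ r : ℝ} (hr : Real.exp (-σ / 2) * ρ ≤ r) :
    (∫ y in ball (0 : ℝ³) ρ, frobeniusNormSq (fderiv ℝ (lerayOrbit u σ) y)) ≤
      3 * Real.exp (-σ / 2) * ∫ x in ball (0 : ℝ³) r, ‖fderiv ℝ (u (-Real.exp (-σ))) x‖ ^ 2 := by
  have hcpos : 0 < Real.exp (-σ / 2) := Real.exp_pos _
  have htneg : -Real.exp (-σ) < 0 := neg_neg_of_pos (Real.exp_pos _)
  have h1 : ContDiff ℝ 1 (u (-Real.exp (-σ))) := (hu.contDiff_slice htneg).of_le (by exact_mod_cast le_top)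
  have hcD : Continuous (fderiv ℝ (u (-Real.exp (-σ)))) := h1.continuous_fderiv one_ne_zero
  -- pointwise
  have hpt : ∀ y, frobeniusNormSq (fderiv ℝ (lerayOrbit u σ) y) ≤
      3 * Real.exp (-σ) ^ 2 * ‖fderiv ℝ (u (-Real.exp (-σ))) (Real.exp (-σ / 2) • y)‖ ^ 2 := by
    intro y
    rw [fderiv_lerayOrbit, frobeniusNormSq_smul]
    have h3 := frobeniusNormSq_le_three_mul_sq (fderiv ℝ (u (-Real.exp (-σ))) (Real.exp (-σ / 2) • y))
    have h0 : 0 ≤ Real.exp (-σ) ^ 2 := sq_nonneg _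
    calc Real.exp (-σ) ^ 2 * frobeniusNormSq (fderiv ℝ (u (-Real.exp (-σ))) (Real.exp (-σ / 2) • y))
        ≤ Real.exp (-σ) ^ 2 * (3 * ‖fderiv ℝ (u (-Real.exp (-σ))) (Real.exp (-σ / 2) • y)‖ ^ 2) :=
          mul_le_mul_of_nonneg_left h3 h0
      _ = 3 * Real.exp (-σ) ^ 2 * ‖fderiv ℝ (u (-Real.exp (-σ))) (Real.exp (-σ / 2) • y)‖ ^ 2 := by ring
  -- integrate over `ball 0 ρ`
  have iL : IntegrableOn (fun y => frobeniusNormSq (fderiv ℝ (lerayOrbit u σ) y)) (ball (0 : ℝ³) ρ) :=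
    integrableOn_frobeniusNormSq_ball hu σ ρ
  have hsm : Continuous fun y : ℝ³ => Real.exp (-σ / 2) • y := continuous_const_smul (Real.exp (-σ / 2))
  have hcomp : Continuous fun y : ℝ³ => fderiv ℝ (u (-Real.exp (-σ))) (Real.exp (-σ / 2) • y) :=
    hcD.comp hsm
  have hcR : Continuous fun y : ℝ³ => 3 * Real.exp (-σ) ^ 2 *
      ‖fderiv ℝ (u (-Real.exp (-σ))) (Real.exp (-σ / 2) • y)‖ ^ 2 :=
    continuous_const.mul ((hcomp.norm).pow 2)
  have iR : IntegrableOn (fun y : ℝ³ => 3 * Real.exp (-σ) ^ 2 *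
      ‖fderiv ℝ (u (-Real.exp (-σ))) (Real.exp (-σ / 2) • y)‖ ^ 2) (ball (0 : ℝ³) ρ) :=
    (hcR.continuousOn.integrableOn_compact (isCompact_closedBall (0 : ℝ³) ρ)).mono_set ball_subset_closedBall
  have hstep1 : (∫ y in ball (0 : ℝ³) ρ, frobeniusNormSq (fderiv ℝ (lerayOrbit u σ) y)) ≤
      ∫ y in ball (0 : ℝ³) ρ, 3 * Real.exp (-σ) ^ 2 *
        ‖fderiv ℝ (u (-Real.exp (-σ))) (Real.exp (-σ / 2) • y)‖ ^ 2 :=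
    setIntegral_mono_on iL iR measurableSet_ball fun y _ => hpt y
  -- change of variables `x = c y`
  have hcov : (∫ y in ball (0 : ℝ³) ρ, 3 * Real.exp (-σ) ^ 2 *
      ‖fderiv ℝ (u (-Real.exp (-σ))) (Real.exp (-σ / 2) • y)‖ ^ 2) =
      3 * Real.exp (-σ) ^ 2 * ((Real.exp (-σ / 2) ^ 3)⁻¹ *
        ∫ x in ball (0 : ℝ³) (Real.exp (-σ / 2) * ρ), ‖fderiv ℝ (u (-Real.exp (-σ))) x‖ ^ 2) := by
    rw [integral_const_mul]
    congr 1
    rw [Measure.setIntegral_comp_smul_of_pos volume (fun x => ‖fderiv ℝ (u (-Real.exp (-σ))) x‖ ^ 2)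
      (ball (0 : ℝ³) ρ) hcpos, smul_eq_mul, finrank_euclideanSpace_fin, smul_ball hcpos.ne' (0 : ℝ³) ρ,
      smul_zero, Real.norm_of_nonneg hcpos.le]
  -- enlarge the ball
  have iBig : IntegrableOn (fun x => ‖fderiv ℝ (u (-Real.exp (-σ))) x‖ ^ 2) (ball (0 : ℝ³) r) :=
    (((hcD.norm).pow 2).continuousOn.integrableOn_compact (isCompact_closedBall (0 : ℝ³) r)).mono_set
      ball_subset_closedBall
  have hstep2 : (∫ x in ball (0 : ℝ³) (Real.exp (-σ / 2) * ρ), ‖fderiv ℝ (u (-Real.exp (-σ))) x‖ ^ 2) ≤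
      ∫ x in ball (0 : ℝ³) r, ‖fderiv ℝ (u (-Real.exp (-σ))) x‖ ^ 2 :=
    setIntegral_mono_set iBig (Eventually.of_forall fun _ => sq_nonneg _)
      (Eventually.of_forall (ball_subset_ball hr))
  -- the coefficient `3 e^{-2σ} c^{-3} = 3 c`
  have hcoef : 3 * Real.exp (-σ) ^ 2 * (Real.exp (-σ / 2) ^ 3)⁻¹ = 3 * Real.exp (-σ / 2) := by
    rw [← exp_neg_half_sq]
    have hc0 : Real.exp (-σ / 2) ≠ 0 := hcpos.ne'
    field_simp
  rw [hcov, ← mul_assoc, hcoef] at hstep1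
  exact hstep1.trans (mul_le_mul_of_nonneg_left hstep2 (by positivity))

omit hu in
/-- The time substitution `t = -e^{-σ}`: derivative `e^{-σ}`. -/
theorem hasDerivAt_negExpNeg (σ : ℝ) : HasDerivAt (fun σ : ℝ => -Real.exp (-σ)) (Real.exp (-σ)) σ := by
  have h1 : HasDerivAt (fun x : ℝ => Real.exp (-x)) (Real.exp (-σ) * (-1)) σ :=
    (Real.hasDerivAt_exp (-σ)).comp σ ((hasDerivAt_id σ).neg)
  have h2 := h1.neg
  have e : -(Real.exp (-σ) * (-1)) = Real.exp (-σ) := by ring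
  rw [e] at h2
  exact h2

omit hu in
/-- `√e ≤ 2`. -/
theorem exp_half_le_two : Real.exp (1 / 2) ≤ 2 := by
  have h1 : Real.exp (1 / 2) ^ 2 = Real.exp 1 := by rw [sq, ← Real.exp_add]; norm_num
  have h2 : Real.exp 1 < 3 := Real.exp_one_lt_three
  have h3 : 0 < Real.exp (1 / 2) := Real.exp_pos _
  nlinarith

/-- **stub_gradEnergyAverage** (core): `∫_s^{s+1} E(ρ, σ) dσ ≤ 6 C ρ` for `ρ ≥ 1`. -/
theorem gradEnergyAverage_core
    (h5 : ∀ (x₀ : EuclideanSpace ℝ (Fin 3)) (t₀ r : ℝ), t₀ ≤ 0 → 0 < r →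
      (∀ t, t₀ - r^2 < t → t < t₀ → r⁻¹ * ∫ x in Metric.ball x₀ r, ‖u t x‖^2 ≤ C) ∧
      r⁻¹ * ∫ t in Set.Ioo (t₀ - r^2) t₀, ∫ x in Metric.ball x₀ r, ‖fderiv ℝ (u t) x‖^2 ≤ C)
    (hEcont : ∀ ρ : ℝ, 0 < ρ →
      Continuous fun s => ∫ y in Metric.ball (0 : ℝ³) ρ, frobeniusNormSq (fderiv ℝ (lerayOrbit u s) y))
    (s ρ : ℝ) (hρ : 1 ≤ ρ) :
    ∫ σ in s..(s + 1), (∫ y in Metric.ball (0 : ℝ³) ρ, frobeniusNormSq (fderiv ℝ (lerayOrbit u σ) y))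
      ≤ 6 * C * ρ := by
  have hC : 0 ≤ C := hu.nonneg
  have hρ0 : 0 < ρ := lt_of_lt_of_le one_pos hρ
  -- the cylinder: radius `r = e^{-s/2} ρ`, top `t₀ = -e^{-(s+1)}`
  set r : ℝ := Real.exp (-s / 2) * ρ with hr
  set t₀ : ℝ := -Real.exp (-(s + 1)) with ht₀
  have hrpos : 0 < r := mul_pos (Real.exp_pos _) hρ0
  have ht₀neg : t₀ < 0 := neg_neg_of_pos (Real.exp_pos _)
  -- the physical local gradient energy at radius `r`
  set g : ℝ → ℝ := fun t => ∫ x in ball (0 : ℝ³) r, ‖fderiv ℝ (u t) x‖ ^ 2 with hg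
  have hg0 : ∀ t, 0 ≤ g t := fun t => ballGrad_nonneg u t r
  -- the substitution
  set f : ℝ → ℝ := fun σ => -Real.exp (-σ) with hf
  have hfmono : StrictMono f := fun a b hab => by
    show -Real.exp (-a) < -Real.exp (-b)
    exact neg_lt_neg (Real.exp_lt_exp.2 (by linarith))
  have hfs : f s = -Real.exp (-s) := rfl
  have hfs1 : f (s + 1) = t₀ := rfl
  have hleft : t₀ - r ^ 2 < f s := by
    rw [hfs, ht₀, hr, mul_pow, exp_neg_half_sq]
    have h1 : Real.exp (-(s + 1)) = Real.exp (-s) * Real.exp (-1) := by rw [← Real.exp_add]; ring_nf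
    rw [h1]
    have h2 : 0 < Real.exp (-1) := Real.exp_pos _
    have h3 : 0 < Real.exp (-s) := Real.exp_pos _
    have h4 : 1 ≤ ρ ^ 2 := by nlinarith
    nlinarith [mul_pos h3 h2, mul_le_mul_of_nonneg_left h4 h3.le]
  -- pointwise bound on `[s, s+1]`: `E(ρ,σ) ≤ K₀ · (f' σ · g (f σ))`, `K₀ = 3 e^{1/2} e^{s/2}`
  set K₀ : ℝ := 3 * Real.exp (1 / 2) * Real.exp (s / 2) with hK₀
  have hK₀0 : 0 ≤ K₀ := by positivity
  have hpt : ∀ σ ∈ Icc s (s + 1),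
      (∫ y in Metric.ball (0 : ℝ³) ρ, frobeniusNormSq (fderiv ℝ (lerayOrbit u σ) y)) ≤
        K₀ * (Real.exp (-σ) * g (f σ)) := by
    intro σ hσ
    have hcr : Real.exp (-σ / 2) * ρ ≤ r := by
      rw [hr]
      exact mul_le_mul_of_nonneg_right (Real.exp_le_exp.2 (by linarith [hσ.1])) hρ0.le
    have h1 := ballGradEnergy_le_scaled hu σ hcr
    have h2 : Real.exp (-σ / 2) ≤ Real.exp (1 / 2) * Real.exp (s / 2) * Real.exp (-σ) := by
      rw [← Real.exp_add, ← Real.exp_add]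
      exact Real.exp_le_exp.2 (by linarith [hσ.2])
    have h3 := mul_le_mul_of_nonneg_right h2 (hg0 (f σ))
    calc (∫ y in Metric.ball (0 : ℝ³) ρ, frobeniusNormSq (fderiv ℝ (lerayOrbit u σ) y))
        ≤ 3 * Real.exp (-σ / 2) * g (f σ) := h1
      _ = 3 * (Real.exp (-σ / 2) * g (f σ)) := by ring
      _ ≤ 3 * (Real.exp (1 / 2) * Real.exp (s / 2) * Real.exp (-σ) * g (f σ)) :=
          mul_le_mul_of_nonneg_left h3 (by norm_num)
      _ = K₀ * (Real.exp (-σ) * g (f σ)) := by rw [hK₀]; ring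
  -- continuity of the majorant on `[s, s+1]`
  have hgcont : ContinuousOn g (Icc (f s) (f (s + 1))) := by
    rw [hfs1]
    exact continuousOn_ballGrad hu r ht₀neg
  have hmaps : MapsTo f (Icc s (s + 1)) (Icc (f s) (f (s + 1))) := fun σ hσ =>
    ⟨hfmono.monotone hσ.1, hfmono.monotone hσ.2⟩
  have hfcont : Continuous f := (Real.continuous_exp.comp continuous_neg).neg
  have hmaj : ContinuousOn (fun σ => K₀ * (Real.exp (-σ) * g (f σ))) (Icc s (s + 1)) :=
    continuousOn_const.mul ((Real.continuous_exp.comp continuous_neg).continuousOn.mul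
      (hgcont.comp hfcont.continuousOn hmaps))
  -- step 1: integrate the pointwise bound over `[s, s+1]`
  have hs1 : s ≤ s + 1 := by linarith
  have hI1 : (∫ σ in s..(s + 1), (∫ y in Metric.ball (0 : ℝ³) ρ, frobeniusNormSq (fderiv ℝ (lerayOrbit u σ) y))) ≤
      ∫ σ in s..(s + 1), K₀ * (Real.exp (-σ) * g (f σ)) := by
    refine intervalIntegral.integral_mono_on hs1 ((hEcont ρ hρ0).intervalIntegrable _ _) ?_ hpt
    exact (hmaj.mono (by rw [uIcc_of_le hs1])).intervalIntegrable
  -- step 2: the substitution `t = f σ` on `Icc s (s+1)`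
  have hcov : (∫ σ in Icc s (s + 1), Real.exp (-σ) * g (f σ)) = ∫ t in f '' Icc s (s + 1), g t := by
    rw [integral_image_eq_integral_abs_deriv_smul measurableSet_Icc
      (fun σ _ => (hasDerivAt_negExpNeg σ).hasDerivWithinAt) (hfmono.injective.injOn) g]
    refine integral_congr_ae (Eventually.of_forall fun σ => ?_)
    show Real.exp (-σ) * g (f σ) = |Real.exp (-σ)| • g (f σ)
    rw [abs_of_pos (Real.exp_pos _), smul_eq_mul]
  have hI2 : (∫ σ in s..(s + 1), K₀ * (Real.exp (-σ) * g (f σ))) = K₀ * ∫ t in f '' Icc s (s + 1), g t := by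
    rw [intervalIntegral.integral_const_mul, intervalIntegral.integral_of_le hs1,
      setIntegral_congr_set Ioc_ae_eq_Icc, hcov]
  -- step 3: enlarge to the H5b cylinder base `Ioo (t₀ - r²) t₀`
  have hgI : IntegrableOn g (Ioo (t₀ - r ^ 2) t₀) :=
    ((continuousOn_ballGrad hu r ht₀neg (α := t₀ - r ^ 2)).integrableOn_compact isCompact_Icc).mono_set
      Ioo_subset_Icc_self
  have hsub : (f '' Icc s (s + 1)) ≤ᵐ[volume] (Ioo (t₀ - r ^ 2) t₀ : Set ℝ) := by
    have hne : ∀ᵐ t ∂(volume : Measure ℝ), t ≠ t₀ := by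
      have : ({t₀}ᶜ : Set ℝ) ∈ ae (volume : Measure ℝ) := compl_mem_ae_iff.2 (measure_singleton t₀)
      filter_upwards [this] with t ht using ht
    filter_upwards [hne] with t ht
    intro hmem
    obtain ⟨σ, hσ, rfl⟩ := hmem
    refine ⟨lt_of_lt_of_le hleft (hfmono.monotone hσ.1), lt_of_le_of_ne ?_ ht⟩
    rw [← hfs1]
    exact hfmono.monotone hσ.2
  have hI3 : (∫ t in f '' Icc s (s + 1), g t) ≤ ∫ t in Ioo (t₀ - r ^ 2) t₀, g t :=
    setIntegral_mono_set hgI (Eventually.of_forall fun t => hg0 t) hsub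
  -- step 4: H5b on the cylinder `Q_r(0, t₀)`
  have hH5 := (h5 0 t₀ r ht₀neg.le hrpos).2
  have hI4 : (∫ t in Ioo (t₀ - r ^ 2) t₀, g t) ≤ r * C := (inv_mul_le_iff₀ hrpos).1 hH5
  -- assemble
  have hKr : K₀ * r = 3 * Real.exp (1 / 2) * ρ := by
    rw [hK₀, hr]
    have : Real.exp (s / 2) * Real.exp (-s / 2) = 1 := by
      rw [← Real.exp_add, show s / 2 + -s / 2 = 0 by ring, Real.exp_zero]
    calc 3 * Real.exp (1 / 2) * Real.exp (s / 2) * (Real.exp (-s / 2) * ρ)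
        = 3 * Real.exp (1 / 2) * (Real.exp (s / 2) * Real.exp (-s / 2)) * ρ := by ring
      _ = 3 * Real.exp (1 / 2) * ρ := by rw [this, mul_one]
  have hfin : K₀ * (r * C) ≤ 6 * C * ρ := by
    have h := exp_half_le_two
    have : K₀ * (r * C) = (3 * Real.exp (1 / 2) * ρ) * C := by rw [← hKr]; ring
    rw [this]
    nlinarith [mul_nonneg hC hρ0.le]
  calc (∫ σ in s..(s + 1), (∫ y in Metric.ball (0 : ℝ³) ρ, frobeniusNormSq (fderiv ℝ (lerayOrbit u σ) y)))
      ≤ K₀ * ∫ t in f '' Icc s (s + 1), g t := by rw [← hI2]; exact hI1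
    _ ≤ K₀ * ∫ t in Ioo (t₀ - r ^ 2) t₀, g t := mul_le_mul_of_nonneg_left hI3 hK₀0
    _ ≤ K₀ * (r * C) := mul_le_mul_of_nonneg_left hI4 hK₀0
    _ ≤ 6 * C * ρ := hfin

end GradEnergy

/-- **stub_gradEnergyAverage**, verbatim signature of the lead's skeleton v1, proved. -/
theorem stub_gradEnergyAverage : ∀ (C : ℝ) (u : ℝ → ℝ³ → ℝ³), IsTypeIAncientMild C u →
    (∀ (x₀ : EuclideanSpace ℝ (Fin 3)) (t₀ r : ℝ), t₀ ≤ 0 → 0 < r →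
      (∀ t, t₀ - r^2 < t → t < t₀ → r⁻¹ * ∫ x in Metric.ball x₀ r, ‖u t x‖^2 ≤ C) ∧
      r⁻¹ * ∫ t in Set.Ioo (t₀ - r^2) t₀, ∫ x in Metric.ball x₀ r, ‖fderiv ℝ (u t) x‖^2 ≤ C) →
    (∀ ρ : ℝ, 0 < ρ →
      Continuous fun s => ∫ y in Metric.ball (0 : ℝ³) ρ, frobeniusNormSq (fderiv ℝ (lerayOrbit u s) y)) →
    ∀ (s ρ : ℝ), 1 ≤ ρ →
      ∫ σ in s..(s + 1), (∫ y in Metric.ball (0 : ℝ³) ρ, frobeniusNormSq (fderiv ℝ (lerayOrbit u σ) y))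
        ≤ 6 * C * ρ :=
  fun _C _u hu h5 hEcont s ρ hρ => gradEnergyAverage_core hu h5 hEcont s ρ hρ

end DrefuteG2

section GenOneTwoPass

open MeasureTheory Set Filter Real intervalIntegral
open scoped Topology Interval

namespace Drefute

/-- `r ≤ ε r² + 1/(4ε)` for `ε > 0` (`(2εr − 1)² ≥ 0`). -/
theorem le_eps_mul_sq (r : ℝ) {ε : ℝ} (hε : 0 < ε) : r ≤ ε * r ^ 2 + 1 / (4 * ε) := by
  have h4 : 0 < 4 * ε := by positivity
  rw [show ε * r ^ 2 + 1 / (4 * ε) = (4 * ε ^ 2 * r ^ 2 + 1) / (4 * ε) by field_simp,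
    le_div_iff₀ h4]
  nlinarith [sq_nonneg (2 * ε * r - 1)]

/-- `√x ≤ εx + 1/(4ε)` for `x ≥ 0`, `ε > 0`. -/
theorem sqrt_le_eps {x ε : ℝ} (hx : 0 ≤ x) (hε : 0 < ε) : Real.sqrt x ≤ ε * x + 1 / (4 * ε) := by
  have h := le_eps_mul_sq (Real.sqrt x) hε
  rwa [Real.sq_sqrt hx] at h

/-- `√x ≤ x + 1/4` for `x ≥ 0`. -/
theorem sqrt_le_add_quarter' {x : ℝ} (hx : 0 ≤ x) : Real.sqrt x ≤ x + 1 / 4 := by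
  have h := sqrt_le_eps hx one_pos
  norm_num at h
  simpa using h

/-- One backward-Grönwall pass, abstract: if `Z` is differentiable with `Z' ≤ −cZ + K`, `K` continuous
nonnegative with `K ≤ κ (F/R + √(F/R))` for a continuous nonnegative `F` whose unit-time integrals are
`≤ A`, and the unit-time integrals of `Z` are bounded, then
`Z s ≤ |κ| (A/R + ε A/R + 1/(4ε)) / (1 − e^{−c})` for every `ε > 0`. -/
theorem one_pass {Z K F : ℝ → ℝ} {c κ R A ε : ℝ} (hc : 0 < c) (hR : 0 < R) (hε : 0 < ε)
    (hZd : Differentiable ℝ Z) (hineq : ∀ s, deriv Z s ≤ -c * Z s + K s) (hKc : Continuous K)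
    (hK0 : ∀ s, 0 ≤ K s) (hKle : ∀ s, K s ≤ κ * (F s / R + Real.sqrt (F s / R)))
    (hFc : Continuous F) (hF0 : ∀ s, 0 ≤ F s) (hFavg : ∀ s, ∫ σ in s..(s + 1), F σ ≤ A)
    (hZavg : ∃ A', ∀ s, ∫ σ in s..(s + 1), Z σ ≤ A') (s : ℝ) :
    Z s ≤ |κ| * (A / R + ε * (A / R) + 1 / (4 * ε)) / (1 - Real.exp (-c)) := by
  -- pointwise bound on `|K|`
  have hpt : ∀ σ, |K σ| ≤ |κ| * (1 + ε) / R * F σ + |κ| / (4 * ε) := by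
    intro σ
    rw [abs_of_nonneg (hK0 σ)]
    have hx : 0 ≤ F σ / R := div_nonneg (hF0 σ) hR.le
    have hX : 0 ≤ F σ / R + Real.sqrt (F σ / R) := add_nonneg hx (Real.sqrt_nonneg _)
    have h1 : K σ ≤ |κ| * (F σ / R + Real.sqrt (F σ / R)) :=
      (hKle σ).trans (mul_le_mul_of_nonneg_right (le_abs_self κ) hX)
    have h2 : Real.sqrt (F σ / R) ≤ ε * (F σ / R) + 1 / (4 * ε) := sqrt_le_eps hx hε
    have h3 : |κ| * (F σ / R + Real.sqrt (F σ / R)) ≤ |κ| * ((1 + ε) * (F σ / R) + 1 / (4 * ε)) :=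
      mul_le_mul_of_nonneg_left (by linarith) (abs_nonneg κ)
    have h4 : |κ| * ((1 + ε) * (F σ / R) + 1 / (4 * ε)) = |κ| * (1 + ε) / R * F σ + |κ| / (4 * ε) := by
      field_simp
    linarith
  have hfi : ∀ s, IntervalIntegrable (fun σ => |K σ|) volume s (s + 1) := fun s =>
    (continuous_abs.comp hKc).intervalIntegrable _ _
  have hgc : Continuous fun σ => |κ| * (1 + ε) / R * F σ + |κ| / (4 * ε) :=
    (continuous_const.mul hFc).add continuous_const
  have hKB : ∀ s, ∫ σ in s..(s + 1), |K σ| ≤ |κ| * (A / R + ε * (A / R) + 1 / (4 * ε)) := by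
    intro s
    have hmono : ∫ σ in s..(s + 1), |K σ| ≤ ∫ σ in s..(s + 1), (|κ| * (1 + ε) / R * F σ + |κ| / (4 * ε)) :=
      intervalIntegral.integral_mono_on (μ := volume) (a := s) (b := s + 1) (by linarith) (hfi s)
        (hgc.intervalIntegrable _ _) (fun σ _ => hpt σ)
    have hf1 : IntervalIntegrable (fun σ => |κ| * (1 + ε) / R * F σ) volume s (s + 1) :=
      (continuous_const.mul hFc).intervalIntegrable _ _
    have hf2 : IntervalIntegrable (fun _ : ℝ => |κ| / (4 * ε)) volume s (s + 1) := intervalIntegrable_const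
    have hcalc : ∫ σ in s..(s + 1), (|κ| * (1 + ε) / R * F σ + |κ| / (4 * ε)) =
        |κ| * (1 + ε) / R * (∫ σ in s..(s + 1), F σ) + |κ| / (4 * ε) := by
      rw [intervalIntegral.integral_add hf1 hf2, intervalIntegral.integral_const_mul,
        intervalIntegral.integral_const, smul_eq_mul]
      ring
    have hcoef : 0 ≤ |κ| * (1 + ε) / R := div_nonneg (by positivity) hR.le
    have h5 : |κ| * (1 + ε) / R * (∫ σ in s..(s + 1), F σ) ≤ |κ| * (1 + ε) / R * A :=
      mul_le_mul_of_nonneg_left (hFavg s) hcoef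
    have h6 : |κ| * (1 + ε) / R * A + |κ| / (4 * ε) = |κ| * (A / R + ε * (A / R) + 1 / (4 * ε)) := by
      field_simp
    linarith
  exact Summit.NavierStokesRegularity.NavierStokesRegularity.Theorems.backward_gronwall_bound hc hZd hineq
    hKc hKB hZavg s

/-- A continuous nonnegative function all of whose unit-time integrals vanish is identically zero. -/
theorem eq_zero_of_unit_integrals_nonpos {f : ℝ → ℝ} (hf : Continuous f) (h0 : ∀ s, 0 ≤ f s)
    (hint : ∀ s, ∫ σ in s..(s + 1), f σ ≤ 0) (s₀ : ℝ) : f s₀ = 0 := by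
  by_contra hne
  have hpos0 : 0 < f s₀ := lt_of_le_of_ne (h0 s₀) (Ne.symm hne)
  set s : ℝ := s₀ - 1 / 2 with hs
  have hfi : IntervalIntegrable f volume s (s + 1) := hf.intervalIntegrable _ _
  have hsupp : IsOpen (Function.support f) := hf.isOpen_support
  have hmem : s₀ ∈ Function.support f ∩ Ioo s (s + 1) := by
    refine ⟨Function.mem_support.2 hne, ?_, ?_⟩ <;> rw [hs] <;> linarith
  have hμ : 0 < volume (Function.support f ∩ Ioc s (s + 1)) := by
    have h1 : 0 < volume (Function.support f ∩ Ioo s (s + 1)) :=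
      (hsupp.inter isOpen_Ioo).measure_pos volume ⟨s₀, hmem⟩
    exact lt_of_lt_of_le h1 (measure_mono (inter_subset_inter_right _ Ioo_subset_Ioc_self))
  have hae : 0 ≤ᵐ[volume.restrict (Ι s (s + 1))] f := Eventually.of_forall fun σ => h0 σ
  have hpos : 0 < ∫ σ in s..(s + 1), f σ :=
    (intervalIntegral.integral_pos_iff_support_of_nonneg_ae' hae hfi).2 ⟨by linarith, hμ⟩
  linarith [hint s]

/-- **`stub_twoPassGronwall`** — verbatim signature of the lead's stub, proved. -/
theorem stub_twoPassGronwall : ∀ (c κ κ' B : ℝ) (Z E : ℝ → ℝ → ℝ), 0 < c →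
    (∀ (ρ s : ℝ), 0 < ρ → 0 ≤ E ρ s) →
    (∀ ρ : ℝ, 0 < ρ → Continuous (E ρ)) →
    (∀ (s ρ ρ' : ℝ), 0 < ρ → ρ ≤ ρ' → E ρ s ≤ E ρ' s) →
    (∀ (s ρ : ℝ), 1 ≤ ρ → ∫ σ in s..(s + 1), E ρ σ ≤ B * ρ) →
    (∀ R : ℝ, 1 ≤ R → Differentiable ℝ (Z R) ∧ ∃ K : ℝ → ℝ, Continuous K ∧ (∀ s, 0 ≤ K s) ∧
      (∀ s, K s ≤ κ * (E (2 * R) s / R + Real.sqrt (E (2 * R) s / R))) ∧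
      ∀ s, deriv (Z R) s ≤ -c * Z R s + K s) →
    (∀ (R s : ℝ), 1 ≤ R → 0 ≤ Z R s) →
    (∀ (R R' s : ℝ), 1 ≤ R → R ≤ R' → Z R s ≤ Z R' s) →
    (∀ (R s : ℝ), 1 ≤ R → Z R s ≤ 6 * E (2 * R) s) →
    (∀ (R s : ℝ), 1 ≤ R → E R s ≤ Z R s + κ' * Real.sqrt (E (2 * R) s / R)) →
    ∀ (ρ s : ℝ), 0 < ρ → E ρ s = 0 := by
  intro c κ κ' B Z E hc hE0 hEc hEmono hEavg hbudget hZ0 hZmono hZE hEZ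
  have hq : 0 < 1 - Real.exp (-c) := by
    have : Real.exp (-c) < 1 := Real.exp_lt_one_iff.2 (by linarith)
    linarith
  -- `0 ≤ B`
  have hB : 0 ≤ B := by
    have h := hEavg 0 1 le_rfl
    have h0 : 0 ≤ ∫ σ in (0 : ℝ)..(0 + 1), E 1 σ :=
      intervalIntegral.integral_nonneg (by norm_num) fun σ _ => hE0 1 σ one_pos
    linarith
  -- unit-time integrals of `Z R` are bounded (Chebyshev input), for each `R ≥ 1`
  have hZavg : ∀ R, 1 ≤ R → ∃ A', ∀ s, ∫ σ in s..(s + 1), Z R σ ≤ A' := by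
    intro R hR
    obtain ⟨hZd, -⟩ := hbudget R hR
    have hE2c : Continuous (E (2 * R)) := hEc _ (by linarith)
    refine ⟨12 * B * R, fun s => ?_⟩
    have hf1 : IntervalIntegrable (fun σ => Z R σ) volume s (s + 1) := hZd.continuous.intervalIntegrable _ _
    have hf2 : IntervalIntegrable (fun σ => 6 * E (2 * R) σ) volume s (s + 1) :=
      (continuous_const.mul hE2c).intervalIntegrable _ _
    have hmono : ∫ σ in s..(s + 1), Z R σ ≤ ∫ σ in s..(s + 1), 6 * E (2 * R) σ :=
      intervalIntegral.integral_mono_on (μ := volume) (a := s) (b := s + 1) (by linarith) hf1 hf2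
        (fun σ _ => hZE R σ hR)
    have hcm : ∫ σ in s..(s + 1), 6 * E (2 * R) σ = 6 * ∫ σ in s..(s + 1), E (2 * R) σ :=
      intervalIntegral.integral_const_mul _ _
    have h := hEavg s (2 * R) (by linarith)
    nlinarith [hmono, hcm, h]
  -- PASS 1: `Z R s ≤ K₁` uniformly
  set K₁ : ℝ := |κ| * (2 * B + (2 * B) + 1 / 4) / (1 - Real.exp (-c)) with hK₁
  have hK₁0 : 0 ≤ K₁ := by rw [hK₁]; positivity
  have hpass1 : ∀ R s, 1 ≤ R → Z R s ≤ K₁ := by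
    intro R s hR
    obtain ⟨hZd, K, hKc, hK0, hKle, hineq⟩ := hbudget R hR
    have hR0 : 0 < R := by linarith
    have hE2c : Continuous (E (2 * R)) := hEc _ (by linarith)
    have hFavg : ∀ s, ∫ σ in s..(s + 1), E (2 * R) σ ≤ 2 * B * R := by
      intro s; have h := hEavg s (2 * R) (by linarith); linarith
    have h := one_pass (A := 2 * B * R) hc hR0 one_pos hZd hineq hKc hK0 hKle hE2c
      (fun σ => hE0 _ σ (by linarith)) hFavg (hZavg R hR) s
    have e : |κ| * (2 * B * R / R + 1 * (2 * B * R / R) + 1 / (4 * 1)) / (1 - Real.exp (-c)) = K₁ := by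
      rw [hK₁]; field_simp
    linarith [h, e.le, e.ge]
  -- time averages of `E R` are bounded uniformly in `R ≥ 1`
  set K₂ : ℝ := K₁ + |κ'| * (2 * B + 1 / 4) with hK₂
  have hK₂0 : 0 ≤ K₂ := by rw [hK₂]; positivity
  have hEavg2 : ∀ R s, 1 ≤ R → ∫ σ in s..(s + 1), E R σ ≤ K₂ := by
    intro R s hR
    have hR0 : 0 < R := by linarith
    have hERc : Continuous (E R) := hEc _ hR0
    have hE2c : Continuous (E (2 * R)) := hEc _ (by linarith)
    have hpt : ∀ σ, E R σ ≤ |κ'| / R * E (2 * R) σ + (K₁ + |κ'| / 4) := by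
      intro σ
      have hx : 0 ≤ E (2 * R) σ / R := div_nonneg (hE0 _ σ (by linarith)) hR0.le
      have h1 := hEZ R σ hR
      have h2 : κ' * Real.sqrt (E (2 * R) σ / R) ≤ |κ'| * Real.sqrt (E (2 * R) σ / R) :=
        mul_le_mul_of_nonneg_right (le_abs_self κ') (Real.sqrt_nonneg _)
      have h3 : |κ'| * Real.sqrt (E (2 * R) σ / R) ≤ |κ'| * (E (2 * R) σ / R + 1 / 4) :=
        mul_le_mul_of_nonneg_left (sqrt_le_add_quarter' hx) (abs_nonneg κ')
      have h4 : |κ'| * (E (2 * R) σ / R + 1 / 4) = |κ'| / R * E (2 * R) σ + |κ'| / 4 := by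
        field_simp
      linarith [hpass1 R σ hR]
    have hf1 : IntervalIntegrable (fun σ => E R σ) volume s (s + 1) := hERc.intervalIntegrable _ _
    have hgc : Continuous fun σ => |κ'| / R * E (2 * R) σ + (K₁ + |κ'| / 4) :=
      (continuous_const.mul hE2c).add continuous_const
    have hmono : ∫ σ in s..(s + 1), E R σ ≤ ∫ σ in s..(s + 1), (|κ'| / R * E (2 * R) σ + (K₁ + |κ'| / 4)) :=
      intervalIntegral.integral_mono_on (μ := volume) (a := s) (b := s + 1) (by linarith) hf1
        (hgc.intervalIntegrable _ _) (fun σ _ => hpt σ)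
    have hf3 : IntervalIntegrable (fun σ => |κ'| / R * E (2 * R) σ) volume s (s + 1) :=
      (continuous_const.mul hE2c).intervalIntegrable _ _
    have hf4 : IntervalIntegrable (fun _ : ℝ => K₁ + |κ'| / 4) volume s (s + 1) := intervalIntegrable_const
    have hcalc : ∫ σ in s..(s + 1), (|κ'| / R * E (2 * R) σ + (K₁ + |κ'| / 4)) =
        |κ'| / R * (∫ σ in s..(s + 1), E (2 * R) σ) + (K₁ + |κ'| / 4) := by
      rw [intervalIntegral.integral_add hf3 hf4, intervalIntegral.integral_const_mul,
        intervalIntegral.integral_const, smul_eq_mul]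
      ring
    have hcoef : 0 ≤ |κ'| / R := div_nonneg (abs_nonneg _) hR0.le
    have h5 : |κ'| / R * (∫ σ in s..(s + 1), E (2 * R) σ) ≤ |κ'| / R * (2 * B * R) := by
      refine mul_le_mul_of_nonneg_left ?_ hcoef
      have h := hEavg s (2 * R) (by linarith); linarith
    have h6 : |κ'| / R * (2 * B * R) = |κ'| * (2 * B) := by field_simp
    have : |κ'| * (2 * B) + (K₁ + |κ'| / 4) = K₂ := by rw [hK₂]; ring
    linarith
  -- PASS 2: `Z R s ≤ M / √R` for `R ≥ 1`
  set M : ℝ := |κ| * (2 * K₂ + 1 / 4) / (1 - Real.exp (-c)) with hM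
  have hM0 : 0 ≤ M := by rw [hM]; positivity
  have hpass2 : ∀ R s, 1 ≤ R → Z R s ≤ M / Real.sqrt R := by
    intro R s hR
    obtain ⟨hZd, K, hKc, hK0, hKle, hineq⟩ := hbudget R hR
    have hR0 : 0 < R := by linarith
    have hsq : 0 < Real.sqrt R := Real.sqrt_pos.2 hR0
    have hsq1 : 1 ≤ Real.sqrt R := by rw [← Real.sqrt_one]; exact Real.sqrt_le_sqrt hR
    have hsqR : Real.sqrt R * Real.sqrt R = R := Real.mul_self_sqrt hR0.le
    have hE2c : Continuous (E (2 * R)) := hEc _ (by linarith)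
    have hFavg : ∀ s, ∫ σ in s..(s + 1), E (2 * R) σ ≤ K₂ := fun s => hEavg2 (2 * R) s (by linarith)
    have h := one_pass (A := K₂) (ε := Real.sqrt R) hc hR0 hsq hZd hineq hKc hK0 hKle hE2c
      (fun σ => hE0 _ σ (by linarith)) hFavg (hZavg R hR) s
    -- `K₂/R + √R K₂/R + 1/(4√R) ≤ (2K₂ + 1/4)/√R`
    have hb : |κ| * (K₂ / R + Real.sqrt R * (K₂ / R) + 1 / (4 * Real.sqrt R)) ≤
        |κ| * (2 * K₂ + 1 / 4) / Real.sqrt R := by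
      rw [mul_div_assoc]
      refine mul_le_mul_of_nonneg_left ?_ (abs_nonneg κ)
      have e1 : Real.sqrt R * (K₂ / R) = K₂ / Real.sqrt R := by
        rw [eq_div_iff hsq.ne']
        calc Real.sqrt R * (K₂ / R) * Real.sqrt R = (Real.sqrt R * Real.sqrt R) * K₂ / R := by ring
          _ = K₂ := by rw [hsqR]; field_simp
      have e2 : 1 / (4 * Real.sqrt R) = (1 / 4) / Real.sqrt R := by field_simp
      have e3 : K₂ / R ≤ K₂ / Real.sqrt R := by
        apply div_le_div_of_nonneg_left hK₂0 hsq
        calc Real.sqrt R = Real.sqrt R * 1 := (mul_one _).symm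
          _ ≤ Real.sqrt R * Real.sqrt R := mul_le_mul_of_nonneg_left hsq1 hsq.le
          _ = R := hsqR
      rw [e1, e2]
      have : K₂ / Real.sqrt R + K₂ / Real.sqrt R + 1 / 4 / Real.sqrt R = (2 * K₂ + 1 / 4) / Real.sqrt R := by
        field_simp; ring
      linarith
    have hb' : |κ| * (K₂ / R + Real.sqrt R * (K₂ / R) + 1 / (4 * Real.sqrt R)) / (1 - Real.exp (-c)) ≤
        M / Real.sqrt R := by
      have e : M / Real.sqrt R = |κ| * (2 * K₂ + 1 / 4) / Real.sqrt R / (1 - Real.exp (-c)) := by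
        rw [hM]; ring
      rw [e]
      exact div_le_div_of_nonneg_right hb hq.le
    exact h.trans hb'
  -- `Z ≡ 0` on `R ≥ 1`
  have hZzero : ∀ R s, 1 ≤ R → Z R s = 0 := by
    intro R₀ s hR₀
    refine le_antisymm ?_ (hZ0 R₀ s hR₀)
    by_contra hzpos
    rw [not_le] at hzpos
    set z : ℝ := Z R₀ s with hz
    -- choose `T ≥ max R₀ (M/z + 1)` and `R = T²`
    set T : ℝ := max R₀ (M / z + 1) with hT
    have hT1 : 1 ≤ T := le_trans hR₀ (le_max_left _ _)
    have hT0 : 0 ≤ T := by linarith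
    have hTR : R₀ ≤ T ^ 2 := by
      calc R₀ ≤ T := le_max_left _ _
        _ = T * 1 := (mul_one _).symm
        _ ≤ T * T := mul_le_mul_of_nonneg_left hT1 hT0
        _ = T ^ 2 := (sq T).symm
    have hsqT : Real.sqrt (T ^ 2) = T := Real.sqrt_sq hT0
    have h1 : z ≤ Z (T ^ 2) s := hZmono R₀ (T ^ 2) s hR₀ hTR
    have h2 : Z (T ^ 2) s ≤ M / T := by
      have := hpass2 (T ^ 2) s (le_trans hR₀ hTR); rwa [hsqT] at this
    have hTgt : M / z + 1 ≤ T := le_max_right _ _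
    have hTpos : 0 < T := by linarith
    -- `M / T < z`
    have h3 : M / T < z := by
      rw [div_lt_iff₀ hTpos]
      have : M < z * (M / z + 1) := by
        rw [mul_add, mul_div_cancel₀ _ hzpos.ne', mul_one]; linarith
      nlinarith [mul_le_mul_of_nonneg_left hTgt hzpos.le]
    linarith
  -- finally `E ≡ 0`
  intro ρ₀ s₀ hρ₀
  have hEρc : Continuous (E ρ₀) := hEc _ hρ₀
  refine eq_zero_of_unit_integrals_nonpos hEρc (fun σ => hE0 _ σ hρ₀) (fun s => ?_) s₀
  -- `∫_s^{s+1} E ρ₀ ≤ ∫ E R ≤ |κ'| (√R K₂/R + 1/(4√R)) → 0`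
  refine le_of_forall_pos_lt_add fun δ hδ => ?_
  -- choose `R = T²` large
  set L : ℝ := |κ'| * (K₂ + 1 / 4) with hL
  have hL0 : 0 ≤ L := by rw [hL]; positivity
  set T : ℝ := max (max ρ₀ 1) (L / δ + 1) with hT
  have hT1 : 1 ≤ T := le_trans (le_max_right ρ₀ 1) (le_max_left _ _)
  have hT0 : 0 ≤ T := by linarith
  have hTpos : 0 < T := by linarith
  have hTT : T ≤ T ^ 2 := by
    calc T = T * 1 := (mul_one _).symm
      _ ≤ T * T := mul_le_mul_of_nonneg_left hT1 hT0
      _ = T ^ 2 := (sq T).symm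
  set R : ℝ := T ^ 2 with hRdef
  have hR1 : 1 ≤ R := le_trans hT1 hTT
  have hR0 : 0 < R := by linarith
  have hρR : ρ₀ ≤ R := le_trans (le_trans (le_max_left ρ₀ 1) (le_max_left _ _)) hTT
  have hsqR : Real.sqrt R = T := by rw [hRdef]; exact Real.sqrt_sq hT0
  have hERc : Continuous (E R) := hEc _ hR0
  have hE2c : Continuous (E (2 * R)) := hEc _ (by linarith)
  -- monotonicity in the radius
  have hm1 : ∫ σ in s..(s + 1), E ρ₀ σ ≤ ∫ σ in s..(s + 1), E R σ :=
    intervalIntegral.integral_mono_on (μ := volume) (a := s) (b := s + 1) (by linarith)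
      (hEρc.intervalIntegrable _ _) (hERc.intervalIntegrable _ _) (fun σ _ => hEmono σ ρ₀ R hρ₀ hρR)
  -- pointwise: `E R σ ≤ |κ'| (T E(2R)σ/R + 1/(4T))` (using `Z R σ = 0`)
  have hpt : ∀ σ, E R σ ≤ |κ'| * T / R * E (2 * R) σ + |κ'| / (4 * T) := by
    intro σ
    have hx : 0 ≤ E (2 * R) σ / R := div_nonneg (hE0 _ σ (by linarith)) hR0.le
    have h1 := hEZ R σ hR1
    rw [hZzero R σ hR1, zero_add] at h1
    have h2 : κ' * Real.sqrt (E (2 * R) σ / R) ≤ |κ'| * Real.sqrt (E (2 * R) σ / R) :=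
      mul_le_mul_of_nonneg_right (le_abs_self κ') (Real.sqrt_nonneg _)
    have h3 : |κ'| * Real.sqrt (E (2 * R) σ / R) ≤ |κ'| * (T * (E (2 * R) σ / R) + 1 / (4 * T)) :=
      mul_le_mul_of_nonneg_left (sqrt_le_eps hx hTpos) (abs_nonneg κ')
    have h4 : |κ'| * (T * (E (2 * R) σ / R) + 1 / (4 * T)) = |κ'| * T / R * E (2 * R) σ + |κ'| / (4 * T) := by
      field_simp
    linarith
  have hgc : Continuous fun σ => |κ'| * T / R * E (2 * R) σ + |κ'| / (4 * T) :=
    (continuous_const.mul hE2c).add continuous_const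
  have hm2 : ∫ σ in s..(s + 1), E R σ ≤ ∫ σ in s..(s + 1), (|κ'| * T / R * E (2 * R) σ + |κ'| / (4 * T)) :=
    intervalIntegral.integral_mono_on (μ := volume) (a := s) (b := s + 1) (by linarith)
      (hERc.intervalIntegrable _ _) (hgc.intervalIntegrable _ _) (fun σ _ => hpt σ)
  have hf3 : IntervalIntegrable (fun σ => |κ'| * T / R * E (2 * R) σ) volume s (s + 1) :=
    (continuous_const.mul hE2c).intervalIntegrable _ _
  have hf4 : IntervalIntegrable (fun _ : ℝ => |κ'| / (4 * T)) volume s (s + 1) := intervalIntegrable_const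
  have hcalc : ∫ σ in s..(s + 1), (|κ'| * T / R * E (2 * R) σ + |κ'| / (4 * T)) =
      |κ'| * T / R * (∫ σ in s..(s + 1), E (2 * R) σ) + |κ'| / (4 * T) := by
    rw [intervalIntegral.integral_add hf3 hf4, intervalIntegral.integral_const_mul,
      intervalIntegral.integral_const, smul_eq_mul]
    ring
  have hcoef : 0 ≤ |κ'| * T / R := div_nonneg (by positivity) hR0.le
  have h5 : |κ'| * T / R * (∫ σ in s..(s + 1), E (2 * R) σ) ≤ |κ'| * T / R * K₂ :=
    mul_le_mul_of_nonneg_left (hEavg2 (2 * R) s (by linarith)) hcoef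
  -- `|κ'| T K₂ / R + |κ'|/(4T) = L / T` since `R = T²`
  have h6 : |κ'| * T / R * K₂ + |κ'| / (4 * T) = L / T := by
    rw [hL, hRdef]; field_simp
  -- `L / T < δ`
  have h7 : L / T < δ := by
    rw [div_lt_iff₀ hTpos]
    have hTgt : L / δ + 1 ≤ T := le_max_right _ _
    have : L < δ * (L / δ + 1) := by
      rw [mul_add, mul_div_cancel₀ _ hδ.ne', mul_one]; linarith
    nlinarith [mul_le_mul_of_nonneg_left hTgt hδ.le]
  linarith

end Drefute

end GenOneTwoPass

section GenOneBits

open MeasureTheory Set Filter Real Metric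
open scoped ContDiff
open Literature.Analysis.FluidPDE

namespace Drefute

local notation "ℝ³" => EuclideanSpace ℝ (Fin 3)

variable {C : ℝ} {u : ℝ → ℝ³ → ℝ³}

/-- Slices of the similarity orbit of a class element are smooth. -/
theorem contDiff_lerayOrbit_slice (hu : IsTypeIAncientMild C u) (s : ℝ) {n : ℕ∞} :
    ContDiff ℝ n (lerayOrbit u s) := by
  have h : ContDiff ℝ n (Function.uncurry (lerayOrbit u)) :=
    contDiff_uncurry_lerayOrbit (hu.1.of_le (by exact_mod_cast le_top))
  exact h.comp (contDiff_prodMk_right s)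

/-- The Frobenius gradient density of a slice is continuous. -/
theorem continuous_frobeniusNormSq_fderiv_lerayOrbit (hu : IsTypeIAncientMild C u) (s : ℝ) :
    Continuous fun y => frobeniusNormSq (fderiv ℝ (lerayOrbit u s) y) := by
  have hc : Continuous (fderiv ℝ (lerayOrbit u s)) :=
    (contDiff_lerayOrbit_slice hu s (n := 1)).continuous_fderiv one_ne_zero
  unfold frobeniusNormSq
  exact continuous_finsetSum _ fun i _ => ((hc.clm_apply continuous_const).norm).pow 2

/-- **stub_gradEnergyBasic (i)**: `0 ≤ E(ρ, s)`. -/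
theorem ballGradEnergy_nonneg (u : ℝ → ℝ³ → ℝ³) (ρ s : ℝ) :
    0 ≤ ∫ y in ball (0 : ℝ³) ρ, frobeniusNormSq (fderiv ℝ (lerayOrbit u s) y) :=
  setIntegral_nonneg measurableSet_ball fun _ _ => frobeniusNormSq_nonneg _

/-- Integrability of the Frobenius density on balls. -/
theorem integrableOn_frobeniusNormSq_ball (hu : IsTypeIAncientMild C u) (s ρ : ℝ) :
    IntegrableOn (fun y => frobeniusNormSq (fderiv ℝ (lerayOrbit u s) y)) (ball (0 : ℝ³) ρ) :=
  (((continuous_frobeniusNormSq_fderiv_lerayOrbit hu s).continuousOn).integrableOn_compact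
    (isCompact_closedBall (0 : ℝ³) ρ)).mono_set ball_subset_closedBall

/-- **stub_gradEnergyBasic (iii)**: monotonicity of `E(ρ, s)` in `ρ`. -/
theorem ballGradEnergy_mono (hu : IsTypeIAncientMild C u) (s ρ ρ' : ℝ) (hρρ' : ρ ≤ ρ') :
    (∫ y in ball (0 : ℝ³) ρ, frobeniusNormSq (fderiv ℝ (lerayOrbit u s) y)) ≤
      ∫ y in ball (0 : ℝ³) ρ', frobeniusNormSq (fderiv ℝ (lerayOrbit u s) y) :=
  setIntegral_mono_set (integrableOn_frobeniusNormSq_ball hu s ρ')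
    (Eventually.of_forall fun _ => frobeniusNormSq_nonneg _)
    (Eventually.of_forall (ball_subset_ball hρρ'))

/-- The Frobenius gradient density is jointly continuous in `(s, y)`. -/
theorem continuous_frobeniusNormSq_fderiv_lerayOrbit_uncurry (hu : IsTypeIAncientMild C u) :
    Continuous fun p : ℝ × ℝ³ => frobeniusNormSq (fderiv ℝ (lerayOrbit u p.1) p.2) := by
  have hU : ContDiff ℝ ∞ (Function.uncurry (lerayOrbit u)) := contDiff_uncurry_lerayOrbit hu.1
  have hU' : ContDiff ℝ ∞ (Function.uncurry fun (p : ℝ × ℝ³) (q : ℝ³) => lerayOrbit u p.1 q) := by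
    have e : (Function.uncurry fun (p : ℝ × ℝ³) (q : ℝ³) => lerayOrbit u p.1 q) =
        Function.uncurry (lerayOrbit u) ∘ fun r : (ℝ × ℝ³) × ℝ³ => (r.1.1, r.2) := by
      funext r; rfl
    rw [e]
    exact hU.comp ((contDiff_fst.comp contDiff_fst).prodMk contDiff_snd)
  have hD : ContDiff ℝ ∞ fun p : ℝ × ℝ³ => fderiv ℝ (lerayOrbit u p.1) p.2 :=
    hU'.fderiv (m := ∞) (n := ∞) contDiff_snd (by simp)
  have hc : Continuous fun p : ℝ × ℝ³ => fderiv ℝ (lerayOrbit u p.1) p.2 := hD.continuous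
  unfold frobeniusNormSq
  exact continuous_finsetSum _ fun i _ => ((hc.clm_apply continuous_const).norm).pow 2

/-- `B_ρ` and its closure agree up to a null set (the sphere is Lebesgue-null). -/
theorem ball_ae_eq_closedBall' (ρ : ℝ) :
    (ball (0 : ℝ³) ρ : Set ℝ³) =ᵐ[volume] (closedBall (0 : ℝ³) ρ : Set ℝ³) := by
  rw [← ball_union_sphere]
  exact (union_ae_eq_left_of_ae_eq_empty (ae_eq_empty.2 (Measure.addHaar_sphere volume _ _))).symm

/-- **stub_gradEnergyBasic (ii)**: continuity of `s ↦ E(ρ, s)`. -/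
theorem continuous_ballGradEnergy (hu : IsTypeIAncientMild C u) (ρ : ℝ) :
    Continuous fun s => ∫ y in ball (0 : ℝ³) ρ, frobeniusNormSq (fderiv ℝ (lerayOrbit u s) y) := by
  have e : (fun s => ∫ y in ball (0 : ℝ³) ρ, frobeniusNormSq (fderiv ℝ (lerayOrbit u s) y)) =
      fun s => ∫ y in closedBall (0 : ℝ³) ρ, frobeniusNormSq (fderiv ℝ (lerayOrbit u s) y) := by
    funext s
    exact setIntegral_congr_set (ball_ae_eq_closedBall' ρ)
  rw [e]
  exact continuous_parametric_integral_of_continuous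
    (f := fun s y => frobeniusNormSq (fderiv ℝ (lerayOrbit u s) y))
    (continuous_frobeniusNormSq_fderiv_lerayOrbit_uncurry hu) (isCompact_closedBall _ _)

/-- **stub_gradEnergyBasic**, verbatim signature of the lead's stub, proved. -/
theorem stub_gradEnergyBasic : ∀ (C : ℝ) (u : ℝ → ℝ³ → ℝ³), IsTypeIAncientMild C u →
    (∀ (ρ s : ℝ), 0 < ρ →
      0 ≤ ∫ y in Metric.ball (0 : ℝ³) ρ, frobeniusNormSq (fderiv ℝ (lerayOrbit u s) y)) ∧
    (∀ ρ : ℝ, 0 < ρ →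
      Continuous fun s => ∫ y in Metric.ball (0 : ℝ³) ρ, frobeniusNormSq (fderiv ℝ (lerayOrbit u s) y)) ∧
    (∀ (s ρ ρ' : ℝ), 0 < ρ → ρ ≤ ρ' →
      ∫ y in Metric.ball (0 : ℝ³) ρ, frobeniusNormSq (fderiv ℝ (lerayOrbit u s) y) ≤
        ∫ y in Metric.ball (0 : ℝ³) ρ', frobeniusNormSq (fderiv ℝ (lerayOrbit u s) y)) :=
  fun _C u hu => ⟨fun ρ s _ => ballGradEnergy_nonneg u ρ s, fun ρ _ => continuous_ballGradEnergy hu ρ,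
    fun s ρ ρ' _ h => ballGradEnergy_mono hu s ρ ρ' h⟩


end Drefute

end GenOneBits

/-! ## The crux, composed exactly as in the skeleton -/

namespace Summit.NavierStokesRegularity.NavierStokesRegularity.Theorems

open MeasureTheory Set Filter Topology
open scoped RealInnerProductSpace
open Literature.Analysis.FluidPDE
open Summit.NavierStokesRegularity.NavierStokesRegularity.Theses.SqueezeCycle

/-- Physical / similarity space `ℝ³`. -/
local notation "ℝ³" => EuclideanSpace ℝ (Fin 3)

set_option linter.dupNamespace false in
/-- **`MustSqueeze`** (route SqueezeCycle, stmt-NavierStokesRegularity-11610): every Type-I KNSS-mild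
ancient field with scale-invariant energies `≤ C` whose Leray-gauge middle strain eigenvalue is
`≤ 1/8` everywhere vanishes identically — by the signed-drift localisation of the similarity
quarter-law (line `outward-drift-signed-flux`): dictionary, div–curl comparison, localised
enstrophy budget `Z_R' ≤ −2(¼ − ⅛)Z_R + K_R`, two backward-Grönwall passes, endgame. -/
theorem mustSqueeze_outwardDriftSignedFlux :
    Summit.NavierStokesRegularity.NavierStokesRegularity.Theses.SqueezeCycle.MustSqueeze := by
  intro C u hu h6
  obtain ⟨h1, h2, h3, h4, h5⟩ := hu
  -- the inline class is the tree's Type-I KNSS-mild class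
  have hK : IsTypeIAncientMild C u := isTypeIAncientMild_of_squeezeClass h1 h2 h3 h4
  -- H6 is `Λ ≤ 1/8` (Courant–Fischer)
  have hΛ : ∀ t < 0, ∀ x, lerayMiddleStrain u t x ≤ 1 / 8 := fun t ht x =>
    (lerayMiddleStrain_le_iff ht (1 / 8)).2 (h6 t ht x)
  -- the stubs
  obtain ⟨hUle, hMorrey⟩ := stub_simDictionary C u hK h5
  obtain ⟨hE0, hEcont, hEmono⟩ := Drefute.stub_gradEnergyBasic C u hK
  have hEavg := DrefuteG2.stub_gradEnergyAverage C u hK h5 hEcont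
  obtain ⟨κ', hdc⟩ := DrefuteG2.stub_divCurlBalls C u hK hMorrey
  obtain ⟨κ, hbudget⟩ := DrefuteG2.stub_signedBudget C (1 / 8) κ' u hK hΛ (by norm_num) hUle hEcont
    (fun R s hR => (hdc R s hR).2.1)
  -- abstract two-pass Grönwall
  set Z : ℝ → ℝ → ℝ := fun R s =>
    ∫ y, Real.smoothTransition (2 - ‖y‖ ^ 2 / R ^ 2) * ‖lerayVorticity u s y‖ ^ 2 with hZ
  set E : ℝ → ℝ → ℝ := fun ρ s =>
    ∫ y in Metric.ball (0 : ℝ³) ρ, frobeniusNormSq (fderiv ℝ (lerayOrbit u s) y) with hE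
  have hc : (0 : ℝ) < 2 * (1 / 4 - 1 / 8) := by norm_num
  have hZ0 : ∀ R s : ℝ, 1 ≤ R → 0 ≤ Z R s := fun R s _ =>
    integral_nonneg fun y => mul_nonneg (Real.smoothTransition.nonneg _) (sq_nonneg _)
  have hbudget' : ∀ R : ℝ, 1 ≤ R → Differentiable ℝ (Z R) ∧ ∃ K : ℝ → ℝ, Continuous K ∧
      (∀ s, 0 ≤ K s) ∧ (∀ s, K s ≤ κ * (E (2 * R) s / R + Real.sqrt (E (2 * R) s / R))) ∧
      ∀ s, deriv (Z R) s ≤ -(2 * (1 / 4 - 1 / 8)) * Z R s + K s := fun R hR => hbudget R hR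
  have hvan : ∀ ρ s : ℝ, 0 < ρ → E ρ s = 0 :=
    Drefute.stub_twoPassGronwall (2 * (1 / 4 - 1 / 8)) κ κ' (6 * C) Z E hc hE0 hEcont hEmono hEavg hbudget'
      hZ0 (fun R R' s hR hRR' => (hdc R s hR).2.2.2 R' hRR') (fun R s hR => (hdc R s hR).1)
      (fun R s hR => ((hdc R s hR).2.2.1).trans ((hdc R s hR).2.1))
  exact stub_endgame C u hK hMorrey hvan


end Summit.NavierStokesRegularity.NavierStokesRegularity.Theorems
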